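import Literature.Analysis.PDE.InteriorSupBound
import Literature.Analysis.PDE.LaplacianInequalities
import HarnessLib

/-!
# Decay bootstrap for classical solutions of second-order equations close to the Laplacian on
# an exterior region of `ℝ³`

Analysis/PDE support file on the discharge path of
`Literature.Geometry.Lorentzian.exists_conformal_negativeMass_of_massZero` (Schoen–Yau 1979,
Cor. 3.1): the pointwise derivative estimates of Lemma 3.2, (3.9)–(3.11) ("standard interior
estimates", p. 67), for smooth solutions of

  `P u := Σₖₗ aₖₗ ∂ₗ∂ₖ u + Σₖ βₖ ∂ₖ u + c u = g`   on `{|y| > R₀} ⊆ ℝ³`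

whose coefficients approach the flat Laplacian, `Σ|a − δ| ≤ K r⁻²`, `Σ|β| ≤ K r⁻³`,
`|c| ≤ K r⁻⁴`, with first partials `≤ K r⁻³` and second partials `≤ K r⁻⁴`, and whose source
satisfies `∫_{B̄(x,θ|x|)} g² ≤ K|x|⁻⁵`, `∫ (∂g)² ≤ K|x|⁻⁷`, `∫ (∂²g)² ≤ K|x|⁻⁹`.

* `decay_bootstrap` — **the bootstrap**: if moreover `∫_{B̄(x,θ|x|)} u² ≤ K₀ |x|^q` (`q ≥ −1`,
  `0 < θ ≤ 1/4`), then far out `u(x)² ≤ C|x|^{q−3}`, `(∂ₘu)² ≤ C|x|^{q−5}`,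
  `(∂ₙ∂ₘu)² ≤ C|x|^{q−7}`, together with the third and fourth `L²` energies over `B(x, θ|x|/4)`,
  `B(x, θ|x|/8)`. In words: every `L²`-smallness of `u` over the balls `B̄(x, θ|x|)` is converted
  into pointwise smallness of `u, ∂u, ∂²u` with the natural loss of `r^{-3/2}` per unit volume
  and `r⁻¹` per derivative.

The proof is the flat interior `L²` theory of `InteriorL2Estimates.lean` / `InteriorSupBound.lean`
(`ball_estimates_three`: weighted `H¹`/`H²` energies and the pointwise bound through the Newton
kernel in `L²_loc`, for functions with `|Δw| ≤ ε|D²w| + L|Dw| + L²|w| + G`) applied on the balls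
`B̄(x, θ|x|)` (`σ = θ|x|`, `ε = 2Kr⁻²`, `L = M/σ`) to `u`, to its first partials and to its
second partials, whose Laplacian inequalities come from `LaplacianInequalities.lean`
(`abs_laplacian_le_of_eq`, `abs_laplacian_fderiv_le`, `abs_laplacian_fderiv_fderiv_le`): three
nested levels (`level_zero_ball`, `level_one_ball`, `level_two_ball`) with explicit constants,
assembled in `decay_bootstrap`. No maximum principle, Schauder or Moser theory is used; the price
is the requirement that `u` be `C^∞` (here harmless: the solutions are smooth by elliptic
regularity).

Everything is proved; nothing is defined and no named fact is introduced.

## References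

* R. Schoen, S.-T. Yau, *On the proof of the positive mass conjecture in general relativity*,
  Comm. Math. Phys. 65 (1979) 45–76, Lemma 3.2, (3.9)–(3.11), p. 67. [SchoenYauPMT1979]
* D. Gilbarg, N. S. Trudinger, *Elliptic partial differential equations of second order*,
  Springer 2001, §2.4 and Ch. 8 (interior estimates). [GilbargTrudinger2001]
-/

noncomputable section

set_option maxSynthPendingDepth 3

open MeasureTheory Set Filter Topology Real Metric Bornology
open scoped ENNReal Laplacian ContDiff

namespace Literature.Analysis.PDE

open Literature.Analysis.FluidPDE Literature.Analysis.FluidPDE.RieszKernel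
open Literature.Geometry.Lorentzian (E3)

/-! ### Measure-theoretic helpers on `ℝ³` -/

section Helpers

/-- Closed and open balls of `ℝ³` carry the same integrals (spheres are Lebesgue-null). [folklore] -/
theorem setIntegral_closedBall_eq_ball (f : E3 → ℝ) (x : E3) (r : ℝ) :
    ∫ y in closedBall x r, f y = ∫ y in ball x r, f y := by
  refine (setIntegral_congr_set ?_).symm
  refine ae_eq_of_subset_of_measure_ge ball_subset_closedBall ?_
    measurableSet_ball.nullMeasurableSet measure_closedBall_lt_top.ne
  rw [Measure.addHaar_closedBall_eq_addHaar_ball]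

/-- Monotonicity of set integrals of nonnegative continuous functions over compact sets.
[folklore] -/
theorem setIntegral_mono_set_of_continuousOn {f : E3 → ℝ} {s t : Set E3} (ht : IsCompact t)
    (hst : s ⊆ t) (hf : ContinuousOn f t) (h0 : ∀ y ∈ t, 0 ≤ f y) :
    ∫ y in s, f y ≤ ∫ y in t, f y :=
  setIntegral_mono_set (hf.integrableOn_compact ht)
    ((ae_restrict_iff' ht.isClosed.measurableSet).2 (ae_of_all _ h0)) hst.eventuallyLE

end Helpers

/-! ### The standard frame and the interior estimates with crude constants -/

section Weak

/-- **The interior estimates on concentric balls of `ℝ³` with one crude constant.** In the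
standard orthonormal frame of `ℝ³`: there are `M, C₀ ≥ 1` such that, under the hypotheses of
`ball_estimates_three` (with `L = M/σ`),
`∫_{B(x₀,σ/2)} Σ(∂ᵢu)² ≤ C₀ (L² P + Γ/L²)`, `∫_{B(x₀,σ/2)} ΣΣ(∂ⱼ∂ᵢu)² ≤ C₀ (L⁴ P + Γ)` and
`u² ≤ C₀ σ (L⁴ P + Γ)` on `B̄(x₀,σ/2)`, `P = ∫_{B̄(x₀,σ)} u²`, `Γ = ∫_{B̄(x₀,σ)} G²`.
[cite: GilbargTrudinger2001, Thm. 8.8, Thm. 8.17, Thm. 9.11 (classical case)] -/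
theorem ball_estimates_three_weak (b : OrthonormalBasis (Fin 3) ℝ E3) :
    ∃ M C₀ : ℝ, 1 ≤ M ∧ 1 ≤ C₀ ∧ ∀ (U : Set E3) (u G : E3 → ℝ) (x₀ : E3) (σ ε : ℝ),
      IsOpen U → closedBall x₀ σ ⊆ U → ContDiffOn ℝ 3 u U → 0 < σ → 0 ≤ ε → ε ≤ 1 / 10 →
      Continuous G →
      (∀ x ∈ closedBall x₀ σ, |(Δ u) x| ≤
        ε * Real.sqrt (∑ i, ∑ j, (fderiv ℝ (fun y => fderiv ℝ u y
            (b i)) x (b j)) ^ 2)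
          + M / σ * Real.sqrt (∑ i, (fderiv ℝ u x (b i)) ^ 2)
          + (M / σ) ^ 2 * |u x| + G x) →
      (∫ x in ball x₀ (σ / 2), ∑ i, (fderiv ℝ u x (b i)) ^ 2) ≤
          C₀ * ((M / σ) ^ 2 * (∫ x in closedBall x₀ σ, u x ^ 2)
            + (∫ x in closedBall x₀ σ, G x ^ 2) / (M / σ) ^ 2) ∧
        (∫ x in ball x₀ (σ / 2), ∑ i, ∑ j, (fderiv ℝ (fun y => fderiv ℝ u y
            (b i)) x (b j)) ^ 2) ≤
          C₀ * ((M / σ) ^ 4 * (∫ x in closedBall x₀ σ, u x ^ 2) + ∫ x in closedBall x₀ σ, G x ^ 2) ∧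
        ∀ x ∈ closedBall x₀ (σ / 2), u x ^ 2 ≤
          C₀ * σ * ((M / σ) ^ 4 * (∫ x in closedBall x₀ σ, u x ^ 2)
            + ∫ x in closedBall x₀ σ, G x ^ 2) := by
  obtain ⟨M, hM1, hM⟩ := ball_estimates_three b
  set c' : ℝ := 3 * (∫⁻ u in ball (0 : E3) 1, powKer 2 u).toReal / (16 * π ^ 2) with hc'
  have hc'0 : 0 ≤ c' := by
    have : 0 ≤ (∫⁻ u in ball (0 : E3) 1, powKer 2 u).toReal := ENNReal.toReal_nonneg
    positivity
  refine ⟨M, 14080000 * (1 + c'), hM1, by nlinarith, fun U u G x₀ σ ε hU hK hu hσ hε0 hε hG hΔ => ?_⟩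
  obtain ⟨h1, h2, h3⟩ := hM U u G x₀ σ ε hU hK hu hσ hε0 hε hG hΔ
  have hcard : ((Fintype.card (Fin 3) : ℝ) + 1) = 4 := by norm_num
  rw [hcard] at h1 h2 h3
  have hP : 0 ≤ ∫ x in closedBall x₀ σ, u x ^ 2 :=
    setIntegral_nonneg measurableSet_closedBall fun x _ => sq_nonneg _
  have hΓ : 0 ≤ ∫ x in closedBall x₀ σ, G x ^ 2 :=
    setIntegral_nonneg measurableSet_closedBall fun x _ => sq_nonneg _
  have hL : 0 < M / σ := div_pos (by linarith) hσ
  have hL2 : 0 < (M / σ) ^ 2 := by positivity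
  have hL4 : 0 ≤ (M / σ) ^ 4 := by positivity
  refine ⟨?_, ?_, fun x hx => ?_⟩
  · refine h1.trans ?_
    have t1 : 400 * (4 : ℝ) ^ 2 * (M / σ) ^ 2 * (∫ x in closedBall x₀ σ, u x ^ 2) ≤
        14080000 * (1 + c') * ((M / σ) ^ 2 * ∫ x in closedBall x₀ σ, u x ^ 2) := by
      have : 400 * (4 : ℝ) ^ 2 ≤ 14080000 * (1 + c') := by nlinarith
      nlinarith [mul_nonneg hL2.le hP]
    have t2 : 3 * (∫ x in closedBall x₀ σ, G x ^ 2) / (M / σ) ^ 2 ≤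
        14080000 * (1 + c') * ((∫ x in closedBall x₀ σ, G x ^ 2) / (M / σ) ^ 2) := by
      rw [mul_div_assoc]
      have : (3 : ℝ) ≤ 14080000 * (1 + c') := by nlinarith
      exact mul_le_mul_of_nonneg_right this (div_nonneg hΓ hL2.le)
    nlinarith [t1, t2]
  · refine h2.trans ?_
    have t1 : 220000 * (4 : ℝ) ^ 3 * (M / σ) ^ 4 * (∫ x in closedBall x₀ σ, u x ^ 2) ≤
        14080000 * (1 + c') * ((M / σ) ^ 4 * ∫ x in closedBall x₀ σ, u x ^ 2) := by
      have : 220000 * (4 : ℝ) ^ 3 ≤ 14080000 * (1 + c') := by nlinarith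
      nlinarith [mul_nonneg hL4 hP]
    have t2 : 1800 * (4 : ℝ) * (∫ x in closedBall x₀ σ, G x ^ 2) ≤
        14080000 * (1 + c') * ∫ x in closedBall x₀ σ, G x ^ 2 := by
      have : 1800 * (4 : ℝ) ≤ 14080000 * (1 + c') := by nlinarith
      exact mul_le_mul_of_nonneg_right this hΓ
    nlinarith [t1, t2]
  · refine (h3 x hx).trans ?_
    have t1 : c' * σ * (46000 * (4 : ℝ) ^ 3 * (M / σ) ^ 4 * ∫ x in closedBall x₀ σ, u x ^ 2) ≤
        14080000 * (1 + c') * σ * ((M / σ) ^ 4 * ∫ x in closedBall x₀ σ, u x ^ 2) := by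
      have : c' * (46000 * (4 : ℝ) ^ 3) ≤ 14080000 * (1 + c') := by nlinarith
      have := mul_le_mul_of_nonneg_right this (mul_nonneg hσ.le (mul_nonneg hL4 hP))
      nlinarith
    have t2 : c' * σ * (400 * (4 : ℝ) * ∫ x in closedBall x₀ σ, G x ^ 2) ≤
        14080000 * (1 + c') * σ * ∫ x in closedBall x₀ σ, G x ^ 2 := by
      have : c' * (400 * (4 : ℝ)) ≤ 14080000 * (1 + c') := by nlinarith
      have := mul_le_mul_of_nonneg_right this (mul_nonneg hσ.le hΓ)
      nlinarith
    nlinarith [t1, t2]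

end Weak


/-! ### The three levels on one ball -/

section FixedBall

variable {b : OrthonormalBasis (Fin 3) ℝ E3} {M C₀ : ℝ}

/-- Derivatives of functions that agree near a point agree at the point, up to third order
partial derivatives. [folklore] -/
theorem partials_congr_of_eventuallyEq {u u' : E3 → ℝ} {y : E3} (h : u' =ᶠ[𝓝 y] u) :
    u' y = u y ∧ (∀ v, fderiv ℝ u' y v = fderiv ℝ u y v) ∧
    (∀ v w, fderiv ℝ (fun z => fderiv ℝ u' z v) y w = fderiv ℝ (fun z => fderiv ℝ u z v) y w) ∧
    (∀ v w t, fderiv ℝ (fun z => fderiv ℝ (fun z' => fderiv ℝ u' z' v) z w) y t =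
      fderiv ℝ (fun z => fderiv ℝ (fun z' => fderiv ℝ u z' v) z w) y t) := by
  have h1 : ∀ v, (fun z => fderiv ℝ u' z v) =ᶠ[𝓝 y] fun z => fderiv ℝ u z v := fun v =>
    (h.fderiv (𝕜 := ℝ)).mono fun z hz => by
      show fderiv ℝ u' z v = fderiv ℝ u z v
      rw [hz]
  have h2 : ∀ v w, (fun z => fderiv ℝ (fun z' => fderiv ℝ u' z' v) z w) =ᶠ[𝓝 y]
      fun z => fderiv ℝ (fun z' => fderiv ℝ u z' v) z w := fun v w =>
    ((h1 v).fderiv (𝕜 := ℝ)).mono fun z hz => by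
      show fderiv ℝ (fun z' => fderiv ℝ u' z' v) z w = fderiv ℝ (fun z' => fderiv ℝ u z' v) z w
      rw [hz]
  exact ⟨h.self_of_nhds, fun v => by rw [h.fderiv_eq], fun v w => by rw [(h1 v).fderiv_eq],
    fun v w t => by rw [(h2 v w).fderiv_eq]⟩

/-- **Level zero on one ball.** Crude-constant interior estimates (`hMC`, from
`ball_estimates_three_weak`) for a classical solution of
`Σ aₖₗ ∂ₗ∂ₖu + Σ βₖ ∂ₖu + c u = g` on an open `U ⊇ B̄(x, σ)`, with `Σ|aₖₗ - δₖₗ| ≤ ε ≤ 1/10`,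
`Σ|βₖ| ≤ M/σ`, `|c| ≤ (M/σ)²` on the ball: the `H¹`, `H²` energies on `B(x, σ/2)` and `u²` on
`B̄(x, σ/2)` are bounded through `P = ∫_{B̄(x,σ)} u²` and `Γ = ∫_{B̄(x,σ)} g²`.
[cite: GilbargTrudinger2001, Thm. 8.8 and Thm. 8.17 (classical case)] -/
theorem level_zero_ball
    (hMC : ∀ (U : Set E3) (u G : E3 → ℝ) (x₀ : E3) (σ ε : ℝ),
      IsOpen U → closedBall x₀ σ ⊆ U → ContDiffOn ℝ 3 u U → 0 < σ → 0 ≤ ε → ε ≤ 1 / 10 →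
      Continuous G →
      (∀ x ∈ closedBall x₀ σ, |(Δ u) x| ≤
        ε * Real.sqrt (∑ i, ∑ j, (fderiv ℝ (fun y => fderiv ℝ u y (b i)) x (b j)) ^ 2)
          + M / σ * Real.sqrt (∑ i, (fderiv ℝ u x (b i)) ^ 2) + (M / σ) ^ 2 * |u x| + G x) →
      (∫ x in ball x₀ (σ / 2), ∑ i, (fderiv ℝ u x (b i)) ^ 2) ≤
          C₀ * ((M / σ) ^ 2 * (∫ x in closedBall x₀ σ, u x ^ 2)
            + (∫ x in closedBall x₀ σ, G x ^ 2) / (M / σ) ^ 2) ∧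
        (∫ x in ball x₀ (σ / 2), ∑ i, ∑ j, (fderiv ℝ (fun y => fderiv ℝ u y (b i)) x (b j)) ^ 2) ≤
          C₀ * ((M / σ) ^ 4 * (∫ x in closedBall x₀ σ, u x ^ 2) + ∫ x in closedBall x₀ σ, G x ^ 2) ∧
        ∀ x ∈ closedBall x₀ (σ / 2), u x ^ 2 ≤
          C₀ * σ * ((M / σ) ^ 4 * (∫ x in closedBall x₀ σ, u x ^ 2)
            + ∫ x in closedBall x₀ σ, G x ^ 2))
    {U : Set E3} (hU : IsOpen U) {x : E3} {σ : ℝ} (hσ : 0 < σ) (hxU : closedBall x σ ⊆ U)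
    {u g : E3 → ℝ} (hu : ContDiffOn ℝ ∞ u U) (hg : ContDiffOn ℝ ∞ g U)
    {a : Fin 3 → Fin 3 → E3 → ℝ} {β : Fin 3 → E3 → ℝ} {c : E3 → ℝ} {ε : ℝ} (hε0 : 0 ≤ ε)
    (hε : ε ≤ 1 / 10)
    (heq : ∀ z ∈ U, ∑ k, ∑ l, a k l z * fderiv ℝ (fun z' => fderiv ℝ u z' (b k)) z (b l)
        + ∑ k, β k z * fderiv ℝ u z (b k) + c z * u z = g z)
    (ha : ∀ y ∈ closedBall x σ, ∑ k, ∑ l, |a k l y - if k = l then 1 else 0| ≤ ε)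
    (hβ : ∀ y ∈ closedBall x σ, ∑ k, |β k y| ≤ M / σ)
    (hc : ∀ y ∈ closedBall x σ, |c y| ≤ (M / σ) ^ 2) :
    (∫ y in ball x (σ / 2), ∑ i, (fderiv ℝ u y (b i)) ^ 2) ≤
        C₀ * ((M / σ) ^ 2 * (∫ y in closedBall x σ, u y ^ 2)
          + (∫ y in closedBall x σ, g y ^ 2) / (M / σ) ^ 2) ∧
      (∫ y in ball x (σ / 2), ∑ i, ∑ j, (fderiv ℝ (fun z => fderiv ℝ u z (b i)) y (b j)) ^ 2) ≤
        C₀ * ((M / σ) ^ 4 * (∫ y in closedBall x σ, u y ^ 2) + ∫ y in closedBall x σ, g y ^ 2) ∧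
      ∀ y ∈ closedBall x (σ / 2), u y ^ 2 ≤
        C₀ * σ * ((M / σ) ^ 4 * (∫ y in closedBall x σ, u y ^ 2) + ∫ y in closedBall x σ, g y ^ 2) := by
  -- globalise `g` and take `G = |g'|`
  obtain ⟨g', hg', δ', hδ', hgg'⟩ := exists_contDiff_eqOn_ball hU hσ hxU hg
  have hGc : Continuous fun y => |g' y| := continuous_abs.comp hg'.continuous
  have hball : closedBall x σ ⊆ ball x (σ + δ') := closedBall_subset_ball (by linarith)
  -- the Laplacian inequality
  have hΔ : ∀ y ∈ closedBall x σ, |(Δ u) y| ≤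
      ε * Real.sqrt (∑ i, ∑ j, (fderiv ℝ (fun z => fderiv ℝ u z (b i)) y (b j)) ^ 2)
        + M / σ * Real.sqrt (∑ i, (fderiv ℝ u y (b i)) ^ 2) + (M / σ) ^ 2 * |u y| + |g' y| := by
    intro y hy
    have hyU : y ∈ U := hxU hy
    have huy : ContDiffAt ℝ 2 u y :=
      (hu.contDiffAt (hU.mem_nhds hyU)).of_le (WithTop.coe_le_coe.mpr le_top)
    have h := abs_laplacian_le_of_eq b huy (fun k l => a k l y) (fun k => β k y) (c y) (g y)
      (ha y hy) (hβ y hy) (heq y hyU)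
    have hcu : |c y| * |u y| ≤ (M / σ) ^ 2 * |u y| :=
      mul_le_mul_of_nonneg_right (hc y hy) (abs_nonneg _)
    rw [hgg' (hball hy)]
    linarith
  obtain ⟨h1, h2, h3⟩ := hMC U u (fun y => |g' y|) x σ ε hU hxU
    (hu.of_le (WithTop.coe_le_coe.mpr le_top)) hσ hε0 hε hGc hΔ
  have hΓ : ∫ y in closedBall x σ, |g' y| ^ 2 = ∫ y in closedBall x σ, g y ^ 2 :=
    setIntegral_congr_fun measurableSet_closedBall fun y hy => by rw [sq_abs, hgg' (hball hy)]
  rw [hΓ] at h1 h2 h3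
  exact ⟨h1, h2, h3⟩

/-- Pointwise bookkeeping for the level-one error term:
`(|p| + Λ (ΣΣ|xᵢⱼ| + Σ|yᵢ| + |z|))² ≤ 2 p² + 54 Λ² (ΣΣ xᵢⱼ² + Σ yᵢ² + z²)` over `Fin 3`.
[folklore] -/
theorem sq_levelOne_error_le (p Λ z : ℝ) (xx : Fin 3 → Fin 3 → ℝ) (yy : Fin 3 → ℝ) :
    (|p| + Λ * (∑ i, ∑ j, |xx i j| + ∑ i, |yy i| + |z|)) ^ 2 ≤
      2 * p ^ 2 + 54 * Λ ^ 2 * (∑ i, ∑ j, xx i j ^ 2 + ∑ i, yy i ^ 2 + z ^ 2) := by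
  have hA : (∑ i, ∑ j, |xx i j|) ^ 2 ≤ 9 * ∑ i, ∑ j, xx i j ^ 2 := by
    have h1 := sq_sum_le_card_mul_sum_sq (s := Finset.univ) (f := fun i => ∑ j, |xx i j|)
    have h2 : ∀ i, (∑ j, |xx i j|) ^ 2 ≤ 3 * ∑ j, xx i j ^ 2 := fun i => by
      have h := sq_sum_le_card_mul_sum_sq (s := Finset.univ) (f := fun j => |xx i j|)
      simp only [Finset.card_univ, Fintype.card_fin, Nat.cast_ofNat, sq_abs] at h
      exact h
    simp only [Finset.card_univ, Fintype.card_fin, Nat.cast_ofNat] at h1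
    calc (∑ i, ∑ j, |xx i j|) ^ 2 ≤ 3 * ∑ i, (∑ j, |xx i j|) ^ 2 := h1
      _ ≤ 3 * ∑ i, 3 * ∑ j, xx i j ^ 2 := by
          gcongr with i
          exact h2 i
      _ = 9 * ∑ i, ∑ j, xx i j ^ 2 := by rw [← Finset.mul_sum]; ring
  have hB : (∑ i, |yy i|) ^ 2 ≤ 3 * ∑ i, yy i ^ 2 := by
    have h := sq_sum_le_card_mul_sum_sq (s := Finset.univ) (f := fun i => |yy i|)
    simp only [Finset.card_univ, Fintype.card_fin, Nat.cast_ofNat, sq_abs] at h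
    exact h
  set A := ∑ i, ∑ j, |xx i j| with hAdef
  set B := ∑ i, |yy i| with hBdef
  have hS : (A + B + |z|) ^ 2 ≤ 27 * (∑ i, ∑ j, xx i j ^ 2 + ∑ i, yy i ^ 2 + z ^ 2) := by
    have h3 : (A + B + |z|) ^ 2 ≤ 3 * (A ^ 2 + B ^ 2 + |z| ^ 2) := by
      nlinarith [sq_nonneg (A - B), sq_nonneg (A - |z|), sq_nonneg (B - |z|)]
    rw [sq_abs] at h3
    have hX : 0 ≤ ∑ i, ∑ j, xx i j ^ 2 := Finset.sum_nonneg fun i _ => Finset.sum_nonneg fun j _ => sq_nonneg _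
    have hY : 0 ≤ ∑ i, yy i ^ 2 := Finset.sum_nonneg fun i _ => sq_nonneg _
    nlinarith [hA, hB, sq_nonneg z]
  have h2 : (|p| + Λ * (A + B + |z|)) ^ 2 ≤ 2 * |p| ^ 2 + 2 * (Λ * (A + B + |z|)) ^ 2 := by
    nlinarith [sq_nonneg (|p| - Λ * (A + B + |z|))]
  rw [sq_abs] at h2
  have h3 : (Λ * (A + B + |z|)) ^ 2 = Λ ^ 2 * (A + B + |z|) ^ 2 := by ring
  rw [h3] at h2
  have hΛ2 : 0 ≤ Λ ^ 2 := sq_nonneg _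
  nlinarith [mul_le_mul_of_nonneg_left hS hΛ2]

/-- **Level one on one ball.** For the same data on an open `U ⊇ B̄(x, σ₁)` with smooth
coefficients whose first partial derivatives are bounded by `Λ₁` on the ball, the first
derivative `∂ₘu` obeys the crude-constant interior estimates with `P₁ = ∫_{B̄(x,σ₁)} (∂ₘu)²` and
`Γ₁ ≤ 2 ∫_{B̄(x,σ₁)} (∂ₘg)² + 54 Λ₁² ∫_{B̄(x,σ₁)} (ΣΣ(∂ⱼ∂ᵢu)² + Σ(∂ᵢu)² + u²)` (the Laplacian
inequality for `∂ₘu`, `abs_laplacian_fderiv_le`).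
[cite: GilbargTrudinger2001, Thm. 8.10 and Thm. 8.17 (classical case)] -/
theorem level_one_ball (hC0 : 0 ≤ C₀) (hM : 0 < M)
    (hMC : ∀ (U : Set E3) (u G : E3 → ℝ) (x₀ : E3) (σ ε : ℝ),
      IsOpen U → closedBall x₀ σ ⊆ U → ContDiffOn ℝ 3 u U → 0 < σ → 0 ≤ ε → ε ≤ 1 / 10 →
      Continuous G →
      (∀ x ∈ closedBall x₀ σ, |(Δ u) x| ≤
        ε * Real.sqrt (∑ i, ∑ j, (fderiv ℝ (fun y => fderiv ℝ u y (b i)) x (b j)) ^ 2)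
          + M / σ * Real.sqrt (∑ i, (fderiv ℝ u x (b i)) ^ 2) + (M / σ) ^ 2 * |u x| + G x) →
      (∫ x in ball x₀ (σ / 2), ∑ i, (fderiv ℝ u x (b i)) ^ 2) ≤
          C₀ * ((M / σ) ^ 2 * (∫ x in closedBall x₀ σ, u x ^ 2)
            + (∫ x in closedBall x₀ σ, G x ^ 2) / (M / σ) ^ 2) ∧
        (∫ x in ball x₀ (σ / 2), ∑ i, ∑ j, (fderiv ℝ (fun y => fderiv ℝ u y (b i)) x (b j)) ^ 2) ≤
          C₀ * ((M / σ) ^ 4 * (∫ x in closedBall x₀ σ, u x ^ 2) + ∫ x in closedBall x₀ σ, G x ^ 2) ∧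
        ∀ x ∈ closedBall x₀ (σ / 2), u x ^ 2 ≤
          C₀ * σ * ((M / σ) ^ 4 * (∫ x in closedBall x₀ σ, u x ^ 2)
            + ∫ x in closedBall x₀ σ, G x ^ 2))
    {U : Set E3} (hU : IsOpen U) {x : E3} {σ₁ : ℝ} (hσ : 0 < σ₁) (hxU : closedBall x σ₁ ⊆ U)
    {u g : E3 → ℝ} (hu : ContDiffOn ℝ ∞ u U) (hg : ContDiffOn ℝ ∞ g U)
    {a : Fin 3 → Fin 3 → E3 → ℝ} {β : Fin 3 → E3 → ℝ} {c : E3 → ℝ}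
    (has : ∀ k l, ContDiffOn ℝ ∞ (a k l) U) (hβs : ∀ k, ContDiffOn ℝ ∞ (β k) U)
    (hcs : ContDiffOn ℝ ∞ c U) {ε : ℝ} (hε0 : 0 ≤ ε) (hε : ε ≤ 1 / 10)
    (heq : ∀ z ∈ U, ∑ k, ∑ l, a k l z * fderiv ℝ (fun z' => fderiv ℝ u z' (b k)) z (b l)
        + ∑ k, β k z * fderiv ℝ u z (b k) + c z * u z = g z)
    (ha : ∀ y ∈ closedBall x σ₁, ∑ k, ∑ l, |a k l y - if k = l then 1 else 0| ≤ ε)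
    (hβ : ∀ y ∈ closedBall x σ₁, ∑ k, |β k y| ≤ M / σ₁)
    (hc : ∀ y ∈ closedBall x σ₁, |c y| ≤ (M / σ₁) ^ 2) {Λ₁ : ℝ}
    (hΛ : ∀ y ∈ closedBall x σ₁, ∀ i, (∀ k l, |fderiv ℝ (a k l) y (b i)| ≤ Λ₁) ∧
      (∀ k, |fderiv ℝ (β k) y (b i)| ≤ Λ₁) ∧ |fderiv ℝ c y (b i)| ≤ Λ₁) (m : Fin 3) :
    (∫ y in ball x (σ₁ / 2), ∑ i, (fderiv ℝ (fun z => fderiv ℝ u z (b m)) y (b i)) ^ 2) ≤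
        C₀ * ((M / σ₁) ^ 2 * (∫ y in closedBall x σ₁, (fderiv ℝ u y (b m)) ^ 2)
          + (2 * (∫ y in closedBall x σ₁, (fderiv ℝ g y (b m)) ^ 2)
            + 54 * Λ₁ ^ 2 * ∫ y in closedBall x σ₁,
              (∑ i, ∑ j, (fderiv ℝ (fun z => fderiv ℝ u z (b i)) y (b j)) ^ 2
                + ∑ i, (fderiv ℝ u y (b i)) ^ 2 + u y ^ 2)) / (M / σ₁) ^ 2) ∧
      (∫ y in ball x (σ₁ / 2), ∑ i, ∑ j, (fderiv ℝ (fun z => fderiv ℝ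
          (fun z' => fderiv ℝ u z' (b m)) z (b i)) y (b j)) ^ 2) ≤
        C₀ * ((M / σ₁) ^ 4 * (∫ y in closedBall x σ₁, (fderiv ℝ u y (b m)) ^ 2)
          + (2 * (∫ y in closedBall x σ₁, (fderiv ℝ g y (b m)) ^ 2)
            + 54 * Λ₁ ^ 2 * ∫ y in closedBall x σ₁,
              (∑ i, ∑ j, (fderiv ℝ (fun z => fderiv ℝ u z (b i)) y (b j)) ^ 2
                + ∑ i, (fderiv ℝ u y (b i)) ^ 2 + u y ^ 2))) ∧
      ∀ y ∈ closedBall x (σ₁ / 2), (fderiv ℝ u y (b m)) ^ 2 ≤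
        C₀ * σ₁ * ((M / σ₁) ^ 4 * (∫ y in closedBall x σ₁, (fderiv ℝ u y (b m)) ^ 2)
          + (2 * (∫ y in closedBall x σ₁, (fderiv ℝ g y (b m)) ^ 2)
            + 54 * Λ₁ ^ 2 * ∫ y in closedBall x σ₁,
              (∑ i, ∑ j, (fderiv ℝ (fun z => fderiv ℝ u z (b i)) y (b j)) ^ 2
                + ∑ i, (fderiv ℝ u y (b i)) ^ 2 + u y ^ 2))) := by
  -- globalise `u` and `g`
  obtain ⟨u', hu', δu, hδu, huu'⟩ := exists_contDiff_eqOn_ball hU hσ hxU hu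
  obtain ⟨g', hg', δg, hδg, hgg'⟩ := exists_contDiff_eqOn_ball hU hσ hxU hg
  have hnu : ∀ y ∈ closedBall x σ₁, u' =ᶠ[𝓝 y] u := fun y hy =>
    Filter.eventuallyEq_of_mem (isOpen_ball.mem_nhds (closedBall_subset_ball (by linarith) hy)) huu'
  have hng : ∀ y ∈ closedBall x σ₁, g' =ᶠ[𝓝 y] g := fun y hy =>
    Filter.eventuallyEq_of_mem (isOpen_ball.mem_nhds (closedBall_subset_ball (by linarith) hy)) hgg'
  -- the error function
  set G₁ : E3 → ℝ := fun y => |fderiv ℝ g' y (b m)| + Λ₁ *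
    (∑ i, ∑ j, |fderiv ℝ (fun z => fderiv ℝ u' z (b i)) y (b j)| + ∑ i, |fderiv ℝ u' y (b i)|
      + |u' y|) with hG₁
  have hu'2 : ContDiff ℝ 2 u' := hu'.of_le (WithTop.coe_le_coe.mpr le_top)
  have hg'1 : ContDiff ℝ 1 g' := hg'.of_le (WithTop.coe_le_coe.mpr le_top)
  have hc1u : ∀ i, Continuous fun y => fderiv ℝ u' y (b i) := fun i =>
    (hu'2.continuous_fderiv two_ne_zero).clm_apply continuous_const
  have hc2u : ∀ i j, Continuous fun y => fderiv ℝ (fun z => fderiv ℝ u' z (b i)) y (b j) :=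
    fun i j => continuous_fderiv_fderiv_apply hu'2 (b i) (b j)
  have hc1g : Continuous fun y => fderiv ℝ g' y (b m) :=
    (hg'1.continuous_fderiv one_ne_zero).clm_apply continuous_const
  have hu'c : Continuous u' := hu'.continuous
  have hG₁c : Continuous G₁ := by simp only [hG₁]; fun_prop
  -- `U₁ = ∂ₘ u` and its Laplacian inequality on the ball
  have hU₁ : ContDiffOn ℝ 3 (fun z => fderiv ℝ u z (b m)) U :=
    contDiffOn_fderiv_apply_const hU (n := 3) (hu.of_le (WithTop.coe_le_coe.mpr le_top)) (b m)
  have hu3 : ContDiffOn ℝ 3 u U := hu.of_le (WithTop.coe_le_coe.mpr le_top)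
  have hΔ : ∀ y ∈ closedBall x σ₁, |(Δ fun z => fderiv ℝ u z (b m)) y| ≤
      ε * Real.sqrt (∑ i, ∑ j, (fderiv ℝ (fun z => fderiv ℝ
          (fun z' => fderiv ℝ u z' (b m)) z (b i)) y (b j)) ^ 2)
        + M / σ₁ * Real.sqrt (∑ i, (fderiv ℝ (fun z => fderiv ℝ u z (b m)) y (b i)) ^ 2)
        + (M / σ₁) ^ 2 * |fderiv ℝ u y (b m)| + G₁ y := by
    intro y hy
    have hyU : y ∈ U := hxU hy
    have hnhds : U ∈ 𝓝 y := hU.mem_nhds hyU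
    have had : ∀ k l, DifferentiableAt ℝ (a k l) y := fun k l =>
      ((has k l).contDiffAt hnhds).differentiableAt (by simp)
    have hβd : ∀ k, DifferentiableAt ℝ (β k) y := fun k =>
      ((hβs k).contDiffAt hnhds).differentiableAt (by simp)
    have hcd : DifferentiableAt ℝ c y := (hcs.contDiffAt hnhds).differentiableAt (by simp)
    have h := abs_laplacian_fderiv_le b hU hyU hu3 had hβd hcd heq (ha y hy) (hβ y hy) m
      (fun k l => (hΛ y hy m).1 k l) (fun k => (hΛ y hy m).2.1 k) (hΛ y hy m).2.2
    -- rewrite the right-hand side through `u'`, `g'`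
    obtain ⟨e0, e1, e2, -⟩ := partials_congr_of_eventuallyEq (hnu y hy)
    obtain ⟨-, f1, -, -⟩ := partials_congr_of_eventuallyEq (hng y hy)
    have hGy : G₁ y = |fderiv ℝ g y (b m)| + Λ₁ *
        (∑ i, ∑ j, |fderiv ℝ (fun z => fderiv ℝ u z (b i)) y (b j)| + ∑ i, |fderiv ℝ u y (b i)|
          + |u y|) := by
      simp only [hG₁, e0, e1, e2, f1]
    have hcu : |c y| * |fderiv ℝ u y (b m)| ≤ (M / σ₁) ^ 2 * |fderiv ℝ u y (b m)| :=
      mul_le_mul_of_nonneg_right (hc y hy) (abs_nonneg _)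
    rw [hGy]
    linarith
  obtain ⟨h1, h2, h3⟩ := hMC U (fun z => fderiv ℝ u z (b m)) G₁ x σ₁ ε hU hxU hU₁ hσ hε0 hε hG₁c hΔ
  -- bound `∫ G₁²`
  set Γ' : ℝ := 2 * (∫ y in closedBall x σ₁, (fderiv ℝ g y (b m)) ^ 2)
    + 54 * Λ₁ ^ 2 * ∫ y in closedBall x σ₁,
      (∑ i, ∑ j, (fderiv ℝ (fun z => fderiv ℝ u z (b i)) y (b j)) ^ 2
        + ∑ i, (fderiv ℝ u y (b i)) ^ 2 + u y ^ 2) with hΓ'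
  have hΓle : ∫ y in closedBall x σ₁, G₁ y ^ 2 ≤ Γ' := by
    set Bf : E3 → ℝ := fun y => 2 * (fderiv ℝ g' y (b m)) ^ 2 + 54 * Λ₁ ^ 2 *
      (∑ i, ∑ j, (fderiv ℝ (fun z => fderiv ℝ u' z (b i)) y (b j)) ^ 2
        + ∑ i, (fderiv ℝ u' y (b i)) ^ 2 + u' y ^ 2) with hBf
    have hBc : Continuous Bf := by simp only [hBf]; fun_prop
    have hpt : ∀ y, G₁ y ^ 2 ≤ Bf y := fun y =>
      sq_levelOne_error_le (fderiv ℝ g' y (b m)) Λ₁ (u' y)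
        (fun i j => fderiv ℝ (fun z => fderiv ℝ u' z (b i)) y (b j)) (fun i => fderiv ℝ u' y (b i))
    have hK : IsCompact (closedBall x σ₁) := isCompact_closedBall x σ₁
    have hmono : ∫ y in closedBall x σ₁, G₁ y ^ 2 ≤ ∫ y in closedBall x σ₁, Bf y :=
      setIntegral_mono_on ((hG₁c.pow 2).continuousOn.integrableOn_compact hK)
        (hBc.continuousOn.integrableOn_compact hK) measurableSet_closedBall fun y _ => hpt y
    refine hmono.trans (le_of_eq ?_)
    -- split the integral of `Bf` and return to `u`, `g`
    have hi1 : IntegrableOn (fun y => 2 * (fderiv ℝ g' y (b m)) ^ 2) (closedBall x σ₁) :=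
      (by fun_prop : Continuous fun y => 2 * (fderiv ℝ g' y (b m)) ^ 2).continuousOn.integrableOn_compact hK
    have hi2 : IntegrableOn (fun y => 54 * Λ₁ ^ 2 *
        (∑ i, ∑ j, (fderiv ℝ (fun z => fderiv ℝ u' z (b i)) y (b j)) ^ 2
          + ∑ i, (fderiv ℝ u' y (b i)) ^ 2 + u' y ^ 2)) (closedBall x σ₁) :=
      (by fun_prop : Continuous fun y => 54 * Λ₁ ^ 2 *
        (∑ i, ∑ j, (fderiv ℝ (fun z => fderiv ℝ u' z (b i)) y (b j)) ^ 2
          + ∑ i, (fderiv ℝ u' y (b i)) ^ 2 + u' y ^ 2)).continuousOn.integrableOn_compact hK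
    simp only [hBf]
    rw [integral_add hi1 hi2, integral_const_mul, integral_const_mul, hΓ']
    congr 2
    · exact setIntegral_congr_fun measurableSet_closedBall fun y hy => by
        obtain ⟨-, f1, -, -⟩ := partials_congr_of_eventuallyEq (hng y hy)
        rw [f1]
    · exact setIntegral_congr_fun measurableSet_closedBall fun y hy => by
        obtain ⟨e0, e1, e2, -⟩ := partials_congr_of_eventuallyEq (hnu y hy)
        simp only [e0, e1, e2]
  -- monotonicity in `Γ`
  have hL : 0 < M / σ₁ := div_pos hM hσ
  have hL2 : 0 < (M / σ₁) ^ 2 := by positivity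
  refine ⟨h1.trans ?_, h2.trans ?_, fun y hy => (h3 y hy).trans ?_⟩
  · have := div_le_div_of_nonneg_right hΓle hL2.le
    nlinarith
  · nlinarith
  · have hσ0 : 0 ≤ C₀ * σ₁ := mul_nonneg hC0 hσ.le
    nlinarith

/-- `(ΣΣ|xᵢⱼ| + Σ|yᵢ| + |z|)² ≤ 27 (ΣΣ xᵢⱼ² + Σ yᵢ² + z²)` over `Fin 3`. [folklore] -/
theorem sq_sum_abs_three_le (z : ℝ) (xx : Fin 3 → Fin 3 → ℝ) (yy : Fin 3 → ℝ) :
    (∑ i, ∑ j, |xx i j| + ∑ i, |yy i| + |z|) ^ 2 ≤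
      27 * (∑ i, ∑ j, xx i j ^ 2 + ∑ i, yy i ^ 2 + z ^ 2) := by
  have hA : (∑ i, ∑ j, |xx i j|) ^ 2 ≤ 9 * ∑ i, ∑ j, xx i j ^ 2 := by
    have h1 := sq_sum_le_card_mul_sum_sq (s := Finset.univ) (f := fun i => ∑ j, |xx i j|)
    have h2 : ∀ i, (∑ j, |xx i j|) ^ 2 ≤ 3 * ∑ j, xx i j ^ 2 := fun i => by
      have h := sq_sum_le_card_mul_sum_sq (s := Finset.univ) (f := fun j => |xx i j|)
      simp only [Finset.card_univ, Fintype.card_fin, Nat.cast_ofNat, sq_abs] at h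
      exact h
    simp only [Finset.card_univ, Fintype.card_fin, Nat.cast_ofNat] at h1
    calc (∑ i, ∑ j, |xx i j|) ^ 2 ≤ 3 * ∑ i, (∑ j, |xx i j|) ^ 2 := h1
      _ ≤ 3 * ∑ i, 3 * ∑ j, xx i j ^ 2 := by
          gcongr with i
          exact h2 i
      _ = 9 * ∑ i, ∑ j, xx i j ^ 2 := by rw [← Finset.mul_sum]; ring
  have hB : (∑ i, |yy i|) ^ 2 ≤ 3 * ∑ i, yy i ^ 2 := by
    have h := sq_sum_le_card_mul_sum_sq (s := Finset.univ) (f := fun i => |yy i|)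
    simp only [Finset.card_univ, Fintype.card_fin, Nat.cast_ofNat, sq_abs] at h
    exact h
  set A := ∑ i, ∑ j, |xx i j| with hAdef
  set B := ∑ i, |yy i| with hBdef
  have h3 : (A + B + |z|) ^ 2 ≤ 3 * (A ^ 2 + B ^ 2 + |z| ^ 2) := by
    nlinarith [sq_nonneg (A - B), sq_nonneg (A - |z|), sq_nonneg (B - |z|)]
  rw [sq_abs] at h3
  have hX : 0 ≤ ∑ i, ∑ j, xx i j ^ 2 := Finset.sum_nonneg fun i _ => Finset.sum_nonneg fun j _ => sq_nonneg _
  have hY : 0 ≤ ∑ i, yy i ^ 2 := Finset.sum_nonneg fun i _ => sq_nonneg _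
  nlinarith [hA, hB, sq_nonneg z]

/-- Pointwise bookkeeping for the level-two error term. [folklore] -/
theorem sq_levelTwo_error_le {p Λ₁ Λ₂ A B C QA QB QC : ℝ}
    (hQA : A ^ 2 ≤ 27 * QA) (hQB : B ^ 2 ≤ 27 * QB) (hQC : C ^ 2 ≤ 27 * QC) :
    (|p| + Λ₁ * (A + B) + Λ₂ * C) ^ 2 ≤
      4 * p ^ 2 + 108 * Λ₁ ^ 2 * (QA + QB) + 108 * Λ₂ ^ 2 * QC := by
  have h4 : (|p| + Λ₁ * A + Λ₁ * B + Λ₂ * C) ^ 2 ≤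
      4 * (|p| ^ 2 + (Λ₁ * A) ^ 2 + (Λ₁ * B) ^ 2 + (Λ₂ * C) ^ 2) := by
    nlinarith [sq_nonneg (|p| - Λ₁ * A), sq_nonneg (|p| - Λ₁ * B), sq_nonneg (|p| - Λ₂ * C),
      sq_nonneg (Λ₁ * A - Λ₁ * B), sq_nonneg (Λ₁ * A - Λ₂ * C), sq_nonneg (Λ₁ * B - Λ₂ * C)]
  rw [sq_abs] at h4
  have e : |p| + Λ₁ * (A + B) + Λ₂ * C = |p| + Λ₁ * A + Λ₁ * B + Λ₂ * C := by ring
  rw [e]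
  have t1 : (Λ₁ * A) ^ 2 ≤ 27 * Λ₁ ^ 2 * QA := by nlinarith [sq_nonneg Λ₁]
  have t2 : (Λ₁ * B) ^ 2 ≤ 27 * Λ₁ ^ 2 * QB := by nlinarith [sq_nonneg Λ₁]
  have t3 : (Λ₂ * C) ^ 2 ≤ 27 * Λ₂ ^ 2 * QC := by nlinarith [sq_nonneg Λ₂]
  nlinarith

/-- **Level two on one ball.** For the same data on an open `U ⊇ B̄(x, σ₂)` with smooth
coefficients and right-hand side, first (second) partial derivatives of the coefficients
bounded by `Λ₁` (`Λ₂`) on the ball, the second derivative `U = ∂ₙ∂ₘu` obeys the crude-constant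
interior `H²` and supremum estimates with `P₂ = ∫_{B̄(x,σ₂)} U²` and
`Γ₂ ≤ 4 ∫ (∂ₙ∂ₘg)² + 108 Λ₁² ∫ (Qₘ + Qₙ) + 108 Λ₂² ∫ Q₀` over `B̄(x,σ₂)`,
`Qᵢ = ΣΣ(∂ₗ∂ₖ∂ᵢu)² + Σ(∂ₖ∂ᵢu)² + (∂ᵢu)²`, `Q₀ = ΣΣ(∂ⱼ∂ᵢu)² + Σ(∂ᵢu)² + u²` (the Laplacian
inequality for `∂ₙ∂ₘu`, `abs_laplacian_fderiv_fderiv_le`).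
[cite: GilbargTrudinger2001, Thm. 8.10 and Thm. 8.17 (classical case)] -/
theorem level_two_ball (hC0 : 0 ≤ C₀)
    (hMC : ∀ (U : Set E3) (u G : E3 → ℝ) (x₀ : E3) (σ ε : ℝ),
      IsOpen U → closedBall x₀ σ ⊆ U → ContDiffOn ℝ 3 u U → 0 < σ → 0 ≤ ε → ε ≤ 1 / 10 →
      Continuous G →
      (∀ x ∈ closedBall x₀ σ, |(Δ u) x| ≤
        ε * Real.sqrt (∑ i, ∑ j, (fderiv ℝ (fun y => fderiv ℝ u y (b i)) x (b j)) ^ 2)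
          + M / σ * Real.sqrt (∑ i, (fderiv ℝ u x (b i)) ^ 2) + (M / σ) ^ 2 * |u x| + G x) →
      (∫ x in ball x₀ (σ / 2), ∑ i, (fderiv ℝ u x (b i)) ^ 2) ≤
          C₀ * ((M / σ) ^ 2 * (∫ x in closedBall x₀ σ, u x ^ 2)
            + (∫ x in closedBall x₀ σ, G x ^ 2) / (M / σ) ^ 2) ∧
        (∫ x in ball x₀ (σ / 2), ∑ i, ∑ j, (fderiv ℝ (fun y => fderiv ℝ u y (b i)) x (b j)) ^ 2) ≤
          C₀ * ((M / σ) ^ 4 * (∫ x in closedBall x₀ σ, u x ^ 2) + ∫ x in closedBall x₀ σ, G x ^ 2) ∧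
        ∀ x ∈ closedBall x₀ (σ / 2), u x ^ 2 ≤
          C₀ * σ * ((M / σ) ^ 4 * (∫ x in closedBall x₀ σ, u x ^ 2)
            + ∫ x in closedBall x₀ σ, G x ^ 2))
    {U : Set E3} (hU : IsOpen U) {x : E3} {σ₂ : ℝ} (hσ : 0 < σ₂) (hxU : closedBall x σ₂ ⊆ U)
    {u g : E3 → ℝ} (hu : ContDiffOn ℝ ∞ u U) (hg : ContDiffOn ℝ ∞ g U)
    {a : Fin 3 → Fin 3 → E3 → ℝ} {β : Fin 3 → E3 → ℝ} {c : E3 → ℝ}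
    (has : ∀ k l, ContDiffOn ℝ ∞ (a k l) U) (hβs : ∀ k, ContDiffOn ℝ ∞ (β k) U)
    (hcs : ContDiffOn ℝ ∞ c U) {ε : ℝ} (hε0 : 0 ≤ ε) (hε : ε ≤ 1 / 10)
    (heq : ∀ z ∈ U, ∑ k, ∑ l, a k l z * fderiv ℝ (fun z' => fderiv ℝ u z' (b k)) z (b l)
        + ∑ k, β k z * fderiv ℝ u z (b k) + c z * u z = g z)
    (ha : ∀ y ∈ closedBall x σ₂, ∑ k, ∑ l, |a k l y - if k = l then 1 else 0| ≤ ε)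
    (hβ : ∀ y ∈ closedBall x σ₂, ∑ k, |β k y| ≤ M / σ₂)
    (hc : ∀ y ∈ closedBall x σ₂, |c y| ≤ (M / σ₂) ^ 2) {Λ₁ Λ₂ : ℝ}
    (hΛ₁ : ∀ y ∈ closedBall x σ₂, ∀ i, (∀ k l, |fderiv ℝ (a k l) y (b i)| ≤ Λ₁) ∧
      (∀ k, |fderiv ℝ (β k) y (b i)| ≤ Λ₁) ∧ |fderiv ℝ c y (b i)| ≤ Λ₁)
    (hΛ₂ : ∀ y ∈ closedBall x σ₂, ∀ i j,
      (∀ k l, |fderiv ℝ (fun z => fderiv ℝ (a k l) z (b i)) y (b j)| ≤ Λ₂) ∧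
      (∀ k, |fderiv ℝ (fun z => fderiv ℝ (β k) z (b i)) y (b j)| ≤ Λ₂) ∧
      |fderiv ℝ (fun z => fderiv ℝ c z (b i)) y (b j)| ≤ Λ₂) (m n : Fin 3) :
    (∫ y in ball x (σ₂ / 2), ∑ i, ∑ j, (fderiv ℝ (fun z => fderiv ℝ
        (fun z' => fderiv ℝ (fun z'' => fderiv ℝ u z'' (b m)) z' (b n)) z (b i)) y (b j)) ^ 2) ≤
        C₀ * ((M / σ₂) ^ 4 * (∫ y in closedBall x σ₂,
            (fderiv ℝ (fun z' => fderiv ℝ u z' (b m)) y (b n)) ^ 2)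
          + (4 * (∫ y in closedBall x σ₂, (fderiv ℝ (fun z => fderiv ℝ g z (b m)) y (b n)) ^ 2)
            + 108 * Λ₁ ^ 2 * ((∫ y in closedBall x σ₂,
                (∑ k, ∑ l, (fderiv ℝ (fun z => fderiv ℝ (fun z' => fderiv ℝ u z' (b m)) z (b k))
                    y (b l)) ^ 2
                  + ∑ k, (fderiv ℝ (fun z => fderiv ℝ u z (b m)) y (b k)) ^ 2
                  + (fderiv ℝ u y (b m)) ^ 2))
              + ∫ y in closedBall x σ₂,
                (∑ k, ∑ l, (fderiv ℝ (fun z => fderiv ℝ (fun z' => fderiv ℝ u z' (b n)) z (b k))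
                    y (b l)) ^ 2
                  + ∑ k, (fderiv ℝ (fun z => fderiv ℝ u z (b n)) y (b k)) ^ 2
                  + (fderiv ℝ u y (b n)) ^ 2))
            + 108 * Λ₂ ^ 2 * ∫ y in closedBall x σ₂,
                (∑ i, ∑ j, (fderiv ℝ (fun z => fderiv ℝ u z (b i)) y (b j)) ^ 2
                  + ∑ i, (fderiv ℝ u y (b i)) ^ 2 + u y ^ 2))) ∧
      ∀ y ∈ closedBall x (σ₂ / 2), (fderiv ℝ (fun z' => fderiv ℝ u z' (b m)) y (b n)) ^ 2 ≤
        C₀ * σ₂ * ((M / σ₂) ^ 4 * (∫ y in closedBall x σ₂,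
            (fderiv ℝ (fun z' => fderiv ℝ u z' (b m)) y (b n)) ^ 2)
          + (4 * (∫ y in closedBall x σ₂, (fderiv ℝ (fun z => fderiv ℝ g z (b m)) y (b n)) ^ 2)
            + 108 * Λ₁ ^ 2 * ((∫ y in closedBall x σ₂,
                (∑ k, ∑ l, (fderiv ℝ (fun z => fderiv ℝ (fun z' => fderiv ℝ u z' (b m)) z (b k))
                    y (b l)) ^ 2
                  + ∑ k, (fderiv ℝ (fun z => fderiv ℝ u z (b m)) y (b k)) ^ 2
                  + (fderiv ℝ u y (b m)) ^ 2))
              + ∫ y in closedBall x σ₂,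
                (∑ k, ∑ l, (fderiv ℝ (fun z => fderiv ℝ (fun z' => fderiv ℝ u z' (b n)) z (b k))
                    y (b l)) ^ 2
                  + ∑ k, (fderiv ℝ (fun z => fderiv ℝ u z (b n)) y (b k)) ^ 2
                  + (fderiv ℝ u y (b n)) ^ 2))
            + 108 * Λ₂ ^ 2 * ∫ y in closedBall x σ₂,
                (∑ i, ∑ j, (fderiv ℝ (fun z => fderiv ℝ u z (b i)) y (b j)) ^ 2
                  + ∑ i, (fderiv ℝ u y (b i)) ^ 2 + u y ^ 2))) := by
  -- globalise `u` and `g`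
  obtain ⟨u', hu', δu, hδu, huu'⟩ := exists_contDiff_eqOn_ball hU hσ hxU hu
  obtain ⟨g', hg', δg, hδg, hgg'⟩ := exists_contDiff_eqOn_ball hU hσ hxU hg
  have hnu : ∀ y ∈ closedBall x σ₂, u' =ᶠ[𝓝 y] u := fun y hy =>
    Filter.eventuallyEq_of_mem (isOpen_ball.mem_nhds (closedBall_subset_ball (by linarith) hy)) huu'
  have hng : ∀ y ∈ closedBall x σ₂, g' =ᶠ[𝓝 y] g := fun y hy =>
    Filter.eventuallyEq_of_mem (isOpen_ball.mem_nhds (closedBall_subset_ball (by linarith) hy)) hgg'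
  -- the error function
  set T : Fin 3 → E3 → ℝ := fun i y =>
    ∑ k, ∑ l, |fderiv ℝ (fun z => fderiv ℝ (fun z' => fderiv ℝ u' z' (b i)) z (b k)) y (b l)|
      + ∑ k, |fderiv ℝ (fun z => fderiv ℝ u' z (b i)) y (b k)| + |fderiv ℝ u' y (b i)| with hT
  set S : E3 → ℝ := fun y =>
    ∑ i, ∑ j, |fderiv ℝ (fun z => fderiv ℝ u' z (b i)) y (b j)| + ∑ i, |fderiv ℝ u' y (b i)|
      + |u' y| with hS
  set G₂ : E3 → ℝ := fun y => |fderiv ℝ (fun z => fderiv ℝ g' z (b m)) y (b n)|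
    + Λ₁ * (T m y + T n y) + Λ₂ * S y with hG₂
  have hu'3 : ContDiff ℝ 3 u' := hu'.of_le (WithTop.coe_le_coe.mpr le_top)
  have hu'2 : ContDiff ℝ 2 u' := hu'.of_le (WithTop.coe_le_coe.mpr le_top)
  have hg'2 : ContDiff ℝ 2 g' := hg'.of_le (WithTop.coe_le_coe.mpr le_top)
  have hc1u : ∀ i, Continuous fun y => fderiv ℝ u' y (b i) := fun i =>
    (hu'2.continuous_fderiv two_ne_zero).clm_apply continuous_const
  have hc2u : ∀ i j, Continuous fun y => fderiv ℝ (fun z => fderiv ℝ u' z (b i)) y (b j) :=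
    fun i j => continuous_fderiv_fderiv_apply hu'2 (b i) (b j)
  have hD1u : ∀ i, ContDiff ℝ 2 fun z => fderiv ℝ u' z (b i) := fun i =>
    contDiff_fderiv_apply_const (n := 2) (by exact_mod_cast hu'3) (b i)
  have hc3u : ∀ i k l, Continuous fun y =>
      fderiv ℝ (fun z => fderiv ℝ (fun z' => fderiv ℝ u' z' (b i)) z (b k)) y (b l) :=
    fun i k l => continuous_fderiv_fderiv_apply (hD1u i) (b k) (b l)
  have hc2g : Continuous fun y => fderiv ℝ (fun z => fderiv ℝ g' z (b m)) y (b n) :=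
    continuous_fderiv_fderiv_apply hg'2 (b m) (b n)
  have hu'c : Continuous u' := hu'.continuous
  have hTc : ∀ i, Continuous (T i) := fun i => by simp only [hT]; fun_prop
  have hSc : Continuous S := by simp only [hS]; fun_prop
  have hG₂c : Continuous G₂ := by simp only [hG₂]; fun_prop
  -- `U₂ = ∂ₙ∂ₘ u` and its Laplacian inequality on the ball
  have hu4 : ContDiffOn ℝ 4 u U := hu.of_le (WithTop.coe_le_coe.mpr le_top)
  have hU₁ : ContDiffOn ℝ 4 (fun z => fderiv ℝ u z (b m)) U :=
    contDiffOn_fderiv_apply_const hU (n := 4) (hu.of_le (WithTop.coe_le_coe.mpr le_top)) (b m)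
  have hU₂ : ContDiffOn ℝ 3 (fun z => fderiv ℝ (fun z' => fderiv ℝ u z' (b m)) z (b n)) U :=
    contDiffOn_fderiv_apply_const hU (n := 3) (by exact_mod_cast hU₁) (b n)
  have ha2 : ∀ k l, ContDiffOn ℝ 2 (a k l) U := fun k l =>
    (has k l).of_le (WithTop.coe_le_coe.mpr le_top)
  have hβ2 : ∀ k, ContDiffOn ℝ 2 (β k) U := fun k => (hβs k).of_le (WithTop.coe_le_coe.mpr le_top)
  have hc2 : ContDiffOn ℝ 2 c U := hcs.of_le (WithTop.coe_le_coe.mpr le_top)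
  have hg2 : ContDiffOn ℝ 2 g U := hg.of_le (WithTop.coe_le_coe.mpr le_top)
  have hΔ : ∀ y ∈ closedBall x σ₂, |(Δ fun z => fderiv ℝ (fun z' => fderiv ℝ u z' (b m)) z (b n)) y| ≤
      ε * Real.sqrt (∑ i, ∑ j, (fderiv ℝ (fun z => fderiv ℝ
          (fun z' => fderiv ℝ (fun z'' => fderiv ℝ u z'' (b m)) z' (b n)) z (b i)) y (b j)) ^ 2)
        + M / σ₂ * Real.sqrt (∑ i, (fderiv ℝ
          (fun z => fderiv ℝ (fun z' => fderiv ℝ u z' (b m)) z (b n)) y (b i)) ^ 2)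
        + (M / σ₂) ^ 2 * |fderiv ℝ (fun z' => fderiv ℝ u z' (b m)) y (b n)| + G₂ y := by
    intro y hy
    have hyU : y ∈ U := hxU hy
    have h := abs_laplacian_fderiv_fderiv_le b hU hyU hu4 ha2 hβ2 hc2 hg2 heq (ha y hy) (hβ y hy)
      (fun k l i => (hΛ₁ y hy i).1 k l) (fun k i => (hΛ₁ y hy i).2.1 k) (fun i => (hΛ₁ y hy i).2.2)
      (fun k l i j => (hΛ₂ y hy i j).1 k l) (fun k i j => (hΛ₂ y hy i j).2.1 k)
      (fun i j => (hΛ₂ y hy i j).2.2) m n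
    obtain ⟨e0, e1, e2, e3⟩ := partials_congr_of_eventuallyEq (hnu y hy)
    obtain ⟨-, -, f2, -⟩ := partials_congr_of_eventuallyEq (hng y hy)
    have hTy : ∀ i, T i y =
        ∑ k, ∑ l, |fderiv ℝ (fun z => fderiv ℝ (fun z' => fderiv ℝ u z' (b i)) z (b k)) y (b l)|
          + ∑ k, |fderiv ℝ (fun z => fderiv ℝ u z (b i)) y (b k)| + |fderiv ℝ u y (b i)| := fun i => by
      simp only [hT, e1, e2, e3]
    have hSy : S y = ∑ i, ∑ j, |fderiv ℝ (fun z => fderiv ℝ u z (b i)) y (b j)|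
        + ∑ i, |fderiv ℝ u y (b i)| + |u y| := by
      simp only [hS, e0, e1, e2]
    have hGy : G₂ y = |fderiv ℝ (fun z => fderiv ℝ g z (b m)) y (b n)|
        + Λ₁ * (T m y + T n y) + Λ₂ * S y := by
      simp only [hG₂, f2]
    have hcu : |c y| * |fderiv ℝ (fun z' => fderiv ℝ u z' (b m)) y (b n)| ≤
        (M / σ₂) ^ 2 * |fderiv ℝ (fun z' => fderiv ℝ u z' (b m)) y (b n)| :=
      mul_le_mul_of_nonneg_right (hc y hy) (abs_nonneg _)
    rw [hGy, hTy m, hTy n, hSy]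
    linarith
  obtain ⟨-, h2, h3⟩ := hMC U (fun z => fderiv ℝ (fun z' => fderiv ℝ u z' (b m)) z (b n)) G₂ x σ₂ ε
    hU hxU hU₂ hσ hε0 hε hG₂c hΔ
  -- bound `∫ G₂²`
  set Qf : Fin 3 → E3 → ℝ := fun i y =>
    ∑ k, ∑ l, (fderiv ℝ (fun z => fderiv ℝ (fun z' => fderiv ℝ u z' (b i)) z (b k)) y (b l)) ^ 2
      + ∑ k, (fderiv ℝ (fun z => fderiv ℝ u z (b i)) y (b k)) ^ 2 + (fderiv ℝ u y (b i)) ^ 2 with hQf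
  set Q0f : E3 → ℝ := fun y =>
    ∑ i, ∑ j, (fderiv ℝ (fun z => fderiv ℝ u z (b i)) y (b j)) ^ 2
      + ∑ i, (fderiv ℝ u y (b i)) ^ 2 + u y ^ 2 with hQ0f
  set Γ' : ℝ := 4 * (∫ y in closedBall x σ₂, (fderiv ℝ (fun z => fderiv ℝ g z (b m)) y (b n)) ^ 2)
    + 108 * Λ₁ ^ 2 * ((∫ y in closedBall x σ₂, Qf m y) + ∫ y in closedBall x σ₂, Qf n y)
    + 108 * Λ₂ ^ 2 * ∫ y in closedBall x σ₂, Q0f y with hΓ'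
  have hΓle : ∫ y in closedBall x σ₂, G₂ y ^ 2 ≤ Γ' := by
    -- primed versions of the `Q`'s
    set Qf' : Fin 3 → E3 → ℝ := fun i y =>
      ∑ k, ∑ l, (fderiv ℝ (fun z => fderiv ℝ (fun z' => fderiv ℝ u' z' (b i)) z (b k)) y (b l)) ^ 2
        + ∑ k, (fderiv ℝ (fun z => fderiv ℝ u' z (b i)) y (b k)) ^ 2 + (fderiv ℝ u' y (b i)) ^ 2
      with hQf'
    set Q0f' : E3 → ℝ := fun y =>
      ∑ i, ∑ j, (fderiv ℝ (fun z => fderiv ℝ u' z (b i)) y (b j)) ^ 2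
        + ∑ i, (fderiv ℝ u' y (b i)) ^ 2 + u' y ^ 2 with hQ0f'
    set Bf : E3 → ℝ := fun y => 4 * (fderiv ℝ (fun z => fderiv ℝ g' z (b m)) y (b n)) ^ 2
      + 108 * Λ₁ ^ 2 * (Qf' m y + Qf' n y) + 108 * Λ₂ ^ 2 * Q0f' y with hBf
    have hQc : ∀ i, Continuous (Qf' i) := fun i => by simp only [hQf']; fun_prop
    have hQ0c : Continuous Q0f' := by simp only [hQ0f']; fun_prop
    have hBc : Continuous Bf := by simp only [hBf]; fun_prop
    have hpt : ∀ y, G₂ y ^ 2 ≤ Bf y := by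
      intro y
      have hTsq : ∀ i, T i y ^ 2 ≤ 27 * Qf' i y := fun i =>
        sq_sum_abs_three_le (fderiv ℝ u' y (b i))
          (fun k l => fderiv ℝ (fun z => fderiv ℝ (fun z' => fderiv ℝ u' z' (b i)) z (b k)) y (b l))
          (fun k => fderiv ℝ (fun z => fderiv ℝ u' z (b i)) y (b k))
      have hSsq : S y ^ 2 ≤ 27 * Q0f' y :=
        sq_sum_abs_three_le (u' y) (fun i j => fderiv ℝ (fun z => fderiv ℝ u' z (b i)) y (b j))
          (fun i => fderiv ℝ u' y (b i))
      exact sq_levelTwo_error_le (hTsq m) (hTsq n) hSsq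
    have hK : IsCompact (closedBall x σ₂) := isCompact_closedBall x σ₂
    have hmono : ∫ y in closedBall x σ₂, G₂ y ^ 2 ≤ ∫ y in closedBall x σ₂, Bf y :=
      setIntegral_mono_on ((hG₂c.pow 2).continuousOn.integrableOn_compact hK)
        (hBc.continuousOn.integrableOn_compact hK) measurableSet_closedBall fun y _ => hpt y
    refine hmono.trans (le_of_eq ?_)
    have hi1 : IntegrableOn (fun y => 4 * (fderiv ℝ (fun z => fderiv ℝ g' z (b m)) y (b n)) ^ 2)
        (closedBall x σ₂) :=
      (by fun_prop : Continuous fun y => 4 * (fderiv ℝ (fun z => fderiv ℝ g' z (b m)) y (b n)) ^ 2)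
        |>.continuousOn.integrableOn_compact hK
    have hi2 : IntegrableOn (fun y => 108 * Λ₁ ^ 2 * (Qf' m y + Qf' n y)) (closedBall x σ₂) :=
      (by fun_prop : Continuous fun y => 108 * Λ₁ ^ 2 * (Qf' m y + Qf' n y))
        |>.continuousOn.integrableOn_compact hK
    have hi3 : IntegrableOn (fun y => 108 * Λ₂ ^ 2 * Q0f' y) (closedBall x σ₂) :=
      (by fun_prop : Continuous fun y => 108 * Λ₂ ^ 2 * Q0f' y).continuousOn.integrableOn_compact hK
    have hi12 : IntegrableOn (fun y => 4 * (fderiv ℝ (fun z => fderiv ℝ g' z (b m)) y (b n)) ^ 2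
        + 108 * Λ₁ ^ 2 * (Qf' m y + Qf' n y)) (closedBall x σ₂) := hi1.add hi2
    have hiQm : IntegrableOn (Qf' m) (closedBall x σ₂) := (hQc m).continuousOn.integrableOn_compact hK
    have hiQn : IntegrableOn (Qf' n) (closedBall x σ₂) := (hQc n).continuousOn.integrableOn_compact hK
    simp only [hBf]
    rw [integral_add hi12 hi3, integral_add hi1 hi2, integral_const_mul, integral_const_mul,
      integral_const_mul, integral_add hiQm hiQn, hΓ']
    have eg : ∫ y in closedBall x σ₂, (fderiv ℝ (fun z => fderiv ℝ g' z (b m)) y (b n)) ^ 2 =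
        ∫ y in closedBall x σ₂, (fderiv ℝ (fun z => fderiv ℝ g z (b m)) y (b n)) ^ 2 :=
      setIntegral_congr_fun measurableSet_closedBall fun y hy => by
        obtain ⟨-, -, f2, -⟩ := partials_congr_of_eventuallyEq (hng y hy)
        rw [f2]
    have eQ : ∀ i, ∫ y in closedBall x σ₂, Qf' i y = ∫ y in closedBall x σ₂, Qf i y := fun i =>
      setIntegral_congr_fun measurableSet_closedBall fun y hy => by
        obtain ⟨e0, e1, e2, e3⟩ := partials_congr_of_eventuallyEq (hnu y hy)
        simp only [hQf', hQf, e1, e2, e3]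
    have eQ0 : ∫ y in closedBall x σ₂, Q0f' y = ∫ y in closedBall x σ₂, Q0f y :=
      setIntegral_congr_fun measurableSet_closedBall fun y hy => by
        obtain ⟨e0, e1, e2, -⟩ := partials_congr_of_eventuallyEq (hnu y hy)
        simp only [hQ0f', hQ0f, e0, e1, e2]
    rw [eg, eQ m, eQ n, eQ0]
  -- monotonicity in `Γ`
  refine ⟨h2.trans ?_, fun y hy => (h3 y hy).trans ?_⟩
  · simp only [hΓ', hQf, hQ0f] at hΓle ⊢
    nlinarith
  · have hσ0 : 0 ≤ C₀ * σ₂ := mul_nonneg hC0 hσ.le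
    simp only [hΓ', hQf, hQ0f] at hΓle ⊢
    nlinarith

end FixedBall

/-! ### Helpers for the assembly -/

section AssemblyHelpers

/-- Set integrals of continuous functions: smaller set and smaller nonnegative integrand.
[folklore] -/
theorem setIntegral_le_setIntegral_of_le {f g : E3 → ℝ} {s t : Set E3} (ht : IsCompact t)
    (hst : s ⊆ t) (hf : ContinuousOn f t) (hg : ContinuousOn g t)
    (h0 : ∀ y ∈ t, 0 ≤ f y) (hfg : ∀ y ∈ t, f y ≤ g y) : ∫ y in s, f y ≤ ∫ y in t, g y := by
  have hft : IntegrableOn f t := hf.integrableOn_compact ht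
  have hgt : IntegrableOn g t := hg.integrableOn_compact ht
  calc ∫ y in s, f y ≤ ∫ y in t, f y :=
        setIntegral_mono_set hft ((ae_restrict_iff' ht.isClosed.measurableSet).2 (ae_of_all _ h0))
          hst.eventuallyLE
    _ ≤ ∫ y in t, g y := setIntegral_mono_on hft hgt ht.isClosed.measurableSet hfg

/-- `c₁ r^{p₁} + c₂ r^{p₂} ≤ (c₁ + c₂) r^p` for `r ≥ 1`, `pᵢ ≤ p`, `cᵢ ≥ 0`. [folklore] -/
theorem add_mul_rpow_le {r c₁ c₂ p₁ p₂ p : ℝ} (hr : 1 ≤ r) (h1 : p₁ ≤ p) (h2 : p₂ ≤ p)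
    (hc₁ : 0 ≤ c₁) (hc₂ : 0 ≤ c₂) : c₁ * r ^ p₁ + c₂ * r ^ p₂ ≤ (c₁ + c₂) * r ^ p := by
  have := mul_le_mul_of_nonneg_left (Real.rpow_le_rpow_of_exponent_le hr h1) hc₁
  have := mul_le_mul_of_nonneg_left (Real.rpow_le_rpow_of_exponent_le hr h2) hc₂
  linarith

/-- Points of `B̄(x, θ‖x‖)` have norm at least `(3/4)‖x‖` when `θ ≤ 1/4`. [folklore] -/
theorem norm_ge_of_mem_closedBall {x y : E3} {θ : ℝ} (hθ4 : θ ≤ 1 / 4) (hy : y ∈ closedBall x (θ * ‖x‖)) :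
    3 / 4 * ‖x‖ ≤ ‖y‖ := by
  rw [mem_closedBall, dist_eq_norm] at hy
  have h1 : ‖x‖ ≤ ‖y‖ + ‖y - x‖ := by
    calc ‖x‖ = ‖y - (y - x)‖ := by rw [sub_sub_cancel]
      _ ≤ ‖y‖ + ‖y - x‖ := norm_sub_le _ _
  nlinarith [norm_nonneg x]

/-- Inverse powers on the ball: `‖y‖^{-p} ≤ (4/3)^p ‖x‖^{-p}` for `y ∈ B̄(x, θ‖x‖)`, `θ ≤ 1/4`,
`x ≠ 0`, `p ≥ 0`. [folklore] -/
theorem rpow_neg_le_of_mem_closedBall {x y : E3} {θ p : ℝ} (hθ4 : θ ≤ 1 / 4) (hx : 0 < ‖x‖)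
    (hp : 0 ≤ p) (hy : y ∈ closedBall x (θ * ‖x‖)) :
    ‖y‖ ^ (-p) ≤ (4 / 3) ^ p * ‖x‖ ^ (-p) := by
  have h34 := norm_ge_of_mem_closedBall hθ4 hy
  have hy0 : 0 < ‖y‖ := by linarith
  rw [Real.rpow_neg hy0.le, Real.rpow_neg hx.le]
  have h1 : (3 / 4 * ‖x‖) ^ p ≤ ‖y‖ ^ p := Real.rpow_le_rpow (by positivity) h34 hp
  have h2 : (‖y‖ ^ p)⁻¹ ≤ ((3 / 4 * ‖x‖) ^ p)⁻¹ :=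
    inv_anti₀ (Real.rpow_pos_of_pos (by positivity) p) h1
  have e : (3 / 4 * ‖x‖) ^ p = ((4 / 3 : ℝ) ^ p)⁻¹ * ‖x‖ ^ p := by
    rw [Real.mul_rpow (by norm_num) hx.le, ← Real.inv_rpow (by norm_num : (0:ℝ) ≤ 4 / 3)]
    norm_num
  calc (‖y‖ ^ p)⁻¹ ≤ ((3 / 4 * ‖x‖) ^ p)⁻¹ := h2
    _ = (4 / 3) ^ p * (‖x‖ ^ p)⁻¹ := by rw [e, mul_inv, inv_inv]

end AssemblyHelpers

/-! ### The decay bootstrap -/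

section Bootstrap

set_option maxHeartbeats 1600000 in
/-- **Decay bootstrap on an exterior region of `ℝ³`.** Let `u` be a classical (smooth) solution
of `Σ aₖₗ ∂ₗ∂ₖu + Σ βₖ ∂ₖu + c u = g` on `{‖y‖ > R₀}` whose coefficients approach those of the
Laplacian with the rates of an asymptotically flat metric
(`Σ|aₖₗ − δₖₗ| ≤ K r⁻²`, `Σ|βₖ| ≤ K r⁻³`, `|c| ≤ K r⁻⁴`, first/second partial derivatives of
the coefficients `≤ K r⁻³`, `K r⁻⁴`), with right-hand side controlled in `L²` on the balls
`B̄(x, θ‖x‖)` (`∫ g² ≤ K ‖x‖⁻⁵`, `∫ (∂g)² ≤ K ‖x‖⁻⁷`, `∫ (∂²g)² ≤ K ‖x‖⁻⁹`), and suppose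
`∫_{B̄(x,θ‖x‖)} u² ≤ K₀ ‖x‖^q` for large `‖x‖` (`q ≥ −1`, `0 < θ ≤ 1/4`). Then for large
`‖x‖`: `u(x)² ≲ ‖x‖^{q−3}`, `(∂ₘu(x))² ≲ ‖x‖^{q−5}`, `(∂ₙ∂ₘu(x))² ≲ ‖x‖^{q−7}`,
`∫_{B(x,θ‖x‖/4)} ΣΣ(∂ₗ∂ₖ∂ₘu)² ≲ ‖x‖^{q−6}` and `∫_{B(x,θ‖x‖/8)} ΣΣ(∂ⱼ∂ᵢ∂ₙ∂ₘu)² ≲ ‖x‖^{q−8}`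
(three levels of the interior estimates on the balls `B(x,θ‖x‖) ⊃ B(x,θ‖x‖/2) ⊃ B(x,θ‖x‖/4)`).
This is the mechanism of Schoen–Yau's (3.9) and (3.19)–(3.20) (decay of `v` and of its
derivatives) for smooth solutions.
[cite: SchoenYauPMT1979, proof of Lemma 3.2, (3.9) and (3.19)–(3.20)] -/
theorem decay_bootstrap (b : OrthonormalBasis (Fin 3) ℝ E3)
    {R₀ θ K K₀ q r₁ : ℝ} (hθ : 0 < θ) (hθ4 : θ ≤ 1 / 4) (hq : -1 ≤ q) (hK : 0 ≤ K) (hK₀ : 0 ≤ K₀)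
    {u g : E3 → ℝ} {a : Fin 3 → Fin 3 → E3 → ℝ} {β : Fin 3 → E3 → ℝ} {c : E3 → ℝ}
    (hu : ContDiffOn ℝ ∞ u {y : E3 | R₀ < ‖y‖}) (hg : ContDiffOn ℝ ∞ g {y : E3 | R₀ < ‖y‖})
    (has : ∀ k l, ContDiffOn ℝ ∞ (a k l) {y : E3 | R₀ < ‖y‖})
    (hβs : ∀ k, ContDiffOn ℝ ∞ (β k) {y : E3 | R₀ < ‖y‖}) (hcs : ContDiffOn ℝ ∞ c {y : E3 | R₀ < ‖y‖})
    (heq : ∀ z ∈ {y : E3 | R₀ < ‖y‖},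
      ∑ k, ∑ l, a k l z * fderiv ℝ (fun z' => fderiv ℝ u z' (b k)) z (b l)
        + ∑ k, β k z * fderiv ℝ u z (b k) + c z * u z = g z)
    (hcoef : ∀ y : E3, r₁ ≤ ‖y‖ →
      (∑ k, ∑ l, |a k l y - if k = l then 1 else 0| ≤ K * ‖y‖ ^ (-2 : ℝ)) ∧
      (∑ k, |β k y| ≤ K * ‖y‖ ^ (-3 : ℝ)) ∧ |c y| ≤ K * ‖y‖ ^ (-4 : ℝ) ∧
      (∀ i, (∀ k l, |fderiv ℝ (a k l) y (b i)| ≤ K * ‖y‖ ^ (-3 : ℝ)) ∧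
        (∀ k, |fderiv ℝ (β k) y (b i)| ≤ K * ‖y‖ ^ (-3 : ℝ)) ∧
        |fderiv ℝ c y (b i)| ≤ K * ‖y‖ ^ (-3 : ℝ)) ∧
      (∀ i j, (∀ k l, |fderiv ℝ (fun z => fderiv ℝ (a k l) z (b i)) y (b j)| ≤ K * ‖y‖ ^ (-4 : ℝ)) ∧
        (∀ k, |fderiv ℝ (fun z => fderiv ℝ (β k) z (b i)) y (b j)| ≤ K * ‖y‖ ^ (-4 : ℝ)) ∧
        |fderiv ℝ (fun z => fderiv ℝ c z (b i)) y (b j)| ≤ K * ‖y‖ ^ (-4 : ℝ)))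
    (hG : ∀ x : E3, r₁ ≤ ‖x‖ →
      (∫ y in closedBall x (θ * ‖x‖), g y ^ 2) ≤ K * ‖x‖ ^ (-5 : ℝ) ∧
      (∀ m, (∫ y in closedBall x (θ * ‖x‖), (fderiv ℝ g y (b m)) ^ 2) ≤ K * ‖x‖ ^ (-7 : ℝ)) ∧
      (∀ m n, (∫ y in closedBall x (θ * ‖x‖), (fderiv ℝ (fun z => fderiv ℝ g z (b m)) y (b n)) ^ 2)
        ≤ K * ‖x‖ ^ (-9 : ℝ)))
    (hI : ∀ x : E3, r₁ ≤ ‖x‖ → (∫ y in closedBall x (θ * ‖x‖), u y ^ 2) ≤ K₀ * ‖x‖ ^ q) :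
    ∃ C r₂ : ℝ, ∀ x : E3, r₂ ≤ ‖x‖ →
      u x ^ 2 ≤ C * ‖x‖ ^ (q - 3) ∧
      (∀ m, (fderiv ℝ u x (b m)) ^ 2 ≤ C * ‖x‖ ^ (q - 5)) ∧
      (∀ m n, (fderiv ℝ (fun z => fderiv ℝ u z (b m)) x (b n)) ^ 2 ≤ C * ‖x‖ ^ (q - 7)) ∧
      (∀ m, (∫ y in ball x (θ * ‖x‖ / 4), ∑ k, ∑ l,
          (fderiv ℝ (fun z => fderiv ℝ (fun z' => fderiv ℝ u z' (b m)) z (b k)) y (b l)) ^ 2)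
        ≤ C * ‖x‖ ^ (q - 6)) ∧
      (∀ m n, (∫ y in ball x (θ * ‖x‖ / 8), ∑ i, ∑ j, (fderiv ℝ (fun z => fderiv ℝ
          (fun z' => fderiv ℝ (fun z'' => fderiv ℝ u z'' (b m)) z' (b n)) z (b i)) y (b j)) ^ 2)
        ≤ C * ‖x‖ ^ (q - 8)) := by
  obtain ⟨M, C₀, hM1, hC1, hMC⟩ := ball_estimates_three_weak b
  have hM : 0 < M := by linarith
  have hC0 : 0 ≤ C₀ := by linarith
  -- the constants
  set A₁ : ℝ := C₀ * ((M / θ) ^ 2 * K₀ + K * (θ / M) ^ 2) with hA₁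
  set A₂ : ℝ := C₀ * ((M / θ) ^ 4 * K₀ + K) with hA₂
  set B₁ : ℝ := 2 * K + 486 * K ^ 2 * (A₂ + A₁ + K₀) with hB₁
  set A₃ : ℝ := C₀ * (16 * (M / θ) ^ 4 * A₁ + B₁) with hA₃
  set A₄ : ℝ := C₀ * (4 * (M / θ) ^ 2 * A₁ + B₁ * (θ / M) ^ 2 / 4) with hA₄
  set B₂ : ℝ := 4 * K + 1944 * K ^ 2 * (A₃ + A₄ + A₁) + 1728 * K ^ 2 * (A₂ + A₁ + K₀) with hB₂
  set A₅ : ℝ := C₀ * (256 * (M / θ) ^ 4 * A₂ + B₂) with hA₅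
  have hA₁0 : 0 ≤ A₁ := by positivity
  have hA₂0 : 0 ≤ A₂ := by positivity
  have hB₁0 : 0 ≤ B₁ := by positivity
  have hA₃0 : 0 ≤ A₃ := by positivity
  have hA₄0 : 0 ≤ A₄ := by positivity
  have hB₂0 : 0 ≤ B₂ := by positivity
  have hA₅0 : 0 ≤ A₅ := by positivity
  refine ⟨A₂ + A₃ + A₅, 4 * |R₀| + 4 * |r₁| + 21 * K + 8, fun x hx => ?_⟩
  /- ───── the radius, the ball, the region ───── -/
  obtain ⟨r, hr⟩ : ∃ r : ℝ, r = ‖x‖ := ⟨_, rfl⟩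
  rw [← hr] at hx ⊢
  have hR₀a := abs_nonneg R₀
  have hr₁a := abs_nonneg r₁
  have hr8 : 8 ≤ r := by linarith only [hx, hR₀a, hr₁a, hK]
  have hr1 : 1 ≤ r := by linarith only [hr8]
  have hr0 : 0 < r := by linarith only [hr8]
  have hxr₁ : r₁ ≤ ‖x‖ := by rw [← hr]; linarith only [hx, le_abs_self r₁, hR₀a, hr₁a, hK]
  have hrK : 21 * K + 8 ≤ r := by linarith only [hx, hR₀a, hr₁a]
  obtain ⟨σ, hσdef⟩ : ∃ σ : ℝ, σ = θ * r := ⟨_, rfl⟩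
  rw [← hσdef]
  have hσ : 0 < σ := by rw [hσdef]; exact mul_pos hθ hr0
  set U : Set E3 := {y : E3 | R₀ < ‖y‖} with hUdef
  have hU : IsOpen U := isOpen_lt continuous_const continuous_norm
  have hyball : ∀ y ∈ closedBall x σ, 3 / 4 * r ≤ ‖y‖ := fun y hy => by
    rw [hσdef, hr] at hy; rw [hr]; exact norm_ge_of_mem_closedBall hθ4 hy
  have hxU : closedBall x σ ⊆ U := fun y hy => by
    show R₀ < ‖y‖
    linarith only [hyball y hy, le_abs_self R₀, hx, hR₀a, hr₁a, hK]
  have hyr₁ : ∀ y ∈ closedBall x σ, r₁ ≤ ‖y‖ := fun y hy => by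
    linarith only [hyball y hy, le_abs_self r₁, hx, hR₀a, hr₁a, hK]
  have hypow : ∀ y ∈ closedBall x σ, ∀ p : ℝ, 0 ≤ p → ‖y‖ ^ (-p) ≤ (4 / 3) ^ p * r ^ (-p) := by
    intro y hy p hp
    rw [hσdef, hr] at hy; rw [hr]
    exact rpow_neg_le_of_mem_closedBall hθ4 (by rw [← hr]; exact hr0) hp hy
  -- powers of `r`
  have hpw : ∀ s t : ℝ, r ^ s * r ^ t = r ^ (s + t) := fun s t => (Real.rpow_add hr0 s t).symm
  have hmo : ∀ {s t : ℝ}, s ≤ t → r ^ s ≤ r ^ t := fun hst =>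
    Real.rpow_le_rpow_of_exponent_le hr1 hst
  have hrp0 : ∀ s : ℝ, 0 < r ^ s := fun s => Real.rpow_pos_of_pos hr0 s
  have hrm1 : r ^ (-1 : ℝ) = r⁻¹ := Real.rpow_neg_one r
  /- ───── the coefficient bounds on the ball ───── -/
  obtain ⟨ε, hεdef⟩ : ∃ ε : ℝ, ε = 2 * K * r ^ (-2 : ℝ) := ⟨_, rfl⟩
  have hε0 : 0 ≤ ε := by rw [hεdef]; positivity
  have hKr : K * r⁻¹ ≤ 1 / 21 := by
    rw [mul_inv_le_iff₀ hr0]; linarith only [hrK]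
  have hε : ε ≤ 1 / 10 := by
    have h1 : r ^ (-2 : ℝ) ≤ r ^ (-1 : ℝ) := hmo (by norm_num)
    have h2 := mul_le_mul_of_nonneg_left h1 (by positivity : (0 : ℝ) ≤ 2 * K)
    rw [hrm1] at h2
    rw [hεdef]
    linarith only [h2, hKr]
  obtain ⟨Λ₁, hΛ₁def⟩ : ∃ Λ₁ : ℝ, Λ₁ = 3 * K * r ^ (-3 : ℝ) := ⟨_, rfl⟩
  obtain ⟨Λ₂, hΛ₂def⟩ : ∃ Λ₂ : ℝ, Λ₂ = 4 * K * r ^ (-4 : ℝ) := ⟨_, rfl⟩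
  have hΛ₁0 : 0 ≤ Λ₁ := by rw [hΛ₁def]; positivity
  have hΛ₂0 : 0 ≤ Λ₂ := by rw [hΛ₂def]; positivity
  have h43_2 : (4 / 3 : ℝ) ^ (2 : ℝ) ≤ 2 := by norm_num
  have h43_3 : (4 / 3 : ℝ) ^ (3 : ℝ) ≤ 3 := by norm_num
  have h43_4 : (4 / 3 : ℝ) ^ (4 : ℝ) ≤ 4 := by norm_num
  have hKy : ∀ y ∈ closedBall x σ, ∀ {p c : ℝ}, 0 ≤ p → (4 / 3 : ℝ) ^ p ≤ c →
      K * ‖y‖ ^ (-p) ≤ c * K * r ^ (-p) := by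
    intro y hy p c hp hc
    have h := hypow y hy p hp
    calc K * ‖y‖ ^ (-p) ≤ K * ((4 / 3) ^ p * r ^ (-p)) := mul_le_mul_of_nonneg_left h hK
      _ ≤ K * (c * r ^ (-p)) := by
          refine mul_le_mul_of_nonneg_left ?_ hK
          exact mul_le_mul_of_nonneg_right hc (hrp0 _).le
      _ = c * K * r ^ (-p) := by ring
  have ha' : ∀ y ∈ closedBall x σ, ∑ k, ∑ l, |a k l y - if k = l then 1 else 0| ≤ ε := by
    intro y hy
    have h1 := (hcoef y (hyr₁ y hy)).1
    have h2 := hKy y hy (p := 2) (by norm_num) h43_2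
    rw [hεdef]
    linarith only [h1, h2]
  have hΛ₁ball : ∀ y ∈ closedBall x σ, K * ‖y‖ ^ (-3 : ℝ) ≤ Λ₁ := fun y hy => by
    have := hKy y hy (p := 3) (by norm_num) h43_3
    rw [hΛ₁def]; linarith only [this]
  have hΛ₂ball : ∀ y ∈ closedBall x σ, K * ‖y‖ ^ (-4 : ℝ) ≤ Λ₂ := fun y hy => by
    have := hKy y hy (p := 4) (by norm_num) h43_4
    rw [hΛ₂def]; linarith only [this]
  -- `Λ₁ ≤ M/σ`, `Λ₂ ≤ (M/σ)²`
  have hMθ : (1 : ℝ) ≤ M / θ := by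
    rw [le_div_iff₀ hθ]; nlinarith only [hM1, hθ4, hθ]
  have hL : M / σ = M / θ * r ^ (-1 : ℝ) := by
    rw [hrm1, hσdef]; field_simp
  have hΛ₁L : Λ₁ ≤ M / σ := by
    rw [hL, hΛ₁def]
    have h1 : r ^ (-3 : ℝ) = r ^ (-2 : ℝ) * r ^ (-1 : ℝ) := by rw [hpw]; norm_num
    have h3 : r ^ (-2 : ℝ) ≤ r ^ (-1 : ℝ) := hmo (by norm_num)
    have h4 : 3 * K * r ^ (-2 : ℝ) ≤ 1 := by
      have := mul_le_mul_of_nonneg_left h3 (by positivity : (0 : ℝ) ≤ 3 * K)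
      rw [hrm1] at this
      linarith only [this, hKr]
    rw [h1, ← mul_assoc]
    exact mul_le_mul_of_nonneg_right (h4.trans hMθ) (hrp0 _).le
  have hΛ₂L : Λ₂ ≤ (M / σ) ^ 2 := by
    rw [hL, hΛ₂def, mul_pow]
    have h1 : r ^ (-4 : ℝ) = r ^ (-2 : ℝ) * (r ^ (-1 : ℝ)) ^ 2 := by
      rw [sq, hpw, hpw]; norm_num
    have h3 : r ^ (-2 : ℝ) ≤ r ^ (-1 : ℝ) := hmo (by norm_num)
    have h4 : 4 * K * r ^ (-2 : ℝ) ≤ 1 := by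
      have := mul_le_mul_of_nonneg_left h3 (by positivity : (0 : ℝ) ≤ 4 * K)
      rw [hrm1] at this
      linarith only [this, hKr]
    have h6 : (1 : ℝ) ≤ (M / θ) ^ 2 := by nlinarith only [hMθ]
    rw [h1, ← mul_assoc]
    exact mul_le_mul_of_nonneg_right (h4.trans h6) (sq_nonneg _)
  -- monotone quantities on smaller balls
  have hMσ_mono : ∀ {ρ : ℝ}, 0 < ρ → ρ ≤ σ → M / σ ≤ M / ρ := fun hρ hρσ =>
    div_le_div_of_nonneg_left hM.le hρ hρσ
  have hβ_ball : ∀ y ∈ closedBall x σ, ∑ k, |β k y| ≤ Λ₁ := fun y hy =>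
    ((hcoef y (hyr₁ y hy)).2.1).trans (hΛ₁ball y hy)
  have hc_ball : ∀ y ∈ closedBall x σ, |c y| ≤ Λ₂ := fun y hy =>
    ((hcoef y (hyr₁ y hy)).2.2.1).trans (hΛ₂ball y hy)
  have hΛ₁' : ∀ y ∈ closedBall x σ, ∀ i, (∀ k l, |fderiv ℝ (a k l) y (b i)| ≤ Λ₁) ∧
      (∀ k, |fderiv ℝ (β k) y (b i)| ≤ Λ₁) ∧ |fderiv ℝ c y (b i)| ≤ Λ₁ := by
    intro y hy i
    obtain ⟨h1, h2, h3⟩ := (hcoef y (hyr₁ y hy)).2.2.2.1 i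
    have hb := hΛ₁ball y hy
    exact ⟨fun k l => (h1 k l).trans hb, fun k => (h2 k).trans hb, h3.trans hb⟩
  have hΛ₂' : ∀ y ∈ closedBall x σ, ∀ i j,
      (∀ k l, |fderiv ℝ (fun z => fderiv ℝ (a k l) z (b i)) y (b j)| ≤ Λ₂) ∧
      (∀ k, |fderiv ℝ (fun z => fderiv ℝ (β k) z (b i)) y (b j)| ≤ Λ₂) ∧
      |fderiv ℝ (fun z => fderiv ℝ c z (b i)) y (b j)| ≤ Λ₂ := by
    intro y hy i j
    obtain ⟨h1, h2, h3⟩ := (hcoef y (hyr₁ y hy)).2.2.2.2 i j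
    have hb := hΛ₂ball y hy
    exact ⟨fun k l => (h1 k l).trans hb, fun k => (h2 k).trans hb, h3.trans hb⟩
  /- ───── continuity of `u`, `g` and their partial derivatives on `U` ───── -/
  have hu6 : ContDiffOn ℝ 6 u U := hu.of_le (WithTop.coe_le_coe.mpr le_top)
  have hg6 : ContDiffOn ℝ 6 g U := hg.of_le (WithTop.coe_le_coe.mpr le_top)
  have hu1 : ∀ i, ContDiffOn ℝ 5 (fun y => fderiv ℝ u y (b i)) U := fun i =>
    contDiffOn_fderiv_apply_const hU (n := 5) (by exact_mod_cast hu6) (b i)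
  have hu2 : ∀ i j, ContDiffOn ℝ 4 (fun y => fderiv ℝ (fun z => fderiv ℝ u z (b i)) y (b j)) U :=
    fun i j => contDiffOn_fderiv_apply_const hU (n := 4) (by exact_mod_cast hu1 i) (b j)
  have hu3 : ∀ i j k, ContDiffOn ℝ 3 (fun y => fderiv ℝ (fun z =>
      fderiv ℝ (fun z' => fderiv ℝ u z' (b i)) z (b j)) y (b k)) U :=
    fun i j k => contDiffOn_fderiv_apply_const hU (n := 3) (by exact_mod_cast hu2 i j) (b k)
  have hg1 : ∀ m, ContDiffOn ℝ 5 (fun y => fderiv ℝ g y (b m)) U := fun m =>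
    contDiffOn_fderiv_apply_const hU (n := 5) (by exact_mod_cast hg6) (b m)
  have hg2 : ∀ m n, ContDiffOn ℝ 4 (fun y => fderiv ℝ (fun z => fderiv ℝ g z (b m)) y (b n)) U :=
    fun m n => contDiffOn_fderiv_apply_const hU (n := 4) (by exact_mod_cast hg1 m) (b n)
  have cu0 : ContinuousOn u (closedBall x σ) := hu.continuousOn.mono hxU
  have cu1 : ∀ i, ContinuousOn (fun y => fderiv ℝ u y (b i)) (closedBall x σ) := fun i =>
    (hu1 i).continuousOn.mono hxU
  have cu2 : ∀ i j, ContinuousOn (fun y => fderiv ℝ (fun z => fderiv ℝ u z (b i)) y (b j))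
      (closedBall x σ) := fun i j => (hu2 i j).continuousOn.mono hxU
  have cu3 : ∀ i j k, ContinuousOn (fun y => fderiv ℝ (fun z =>
      fderiv ℝ (fun z' => fderiv ℝ u z' (b i)) z (b j)) y (b k)) (closedBall x σ) :=
    fun i j k => (hu3 i j k).continuousOn.mono hxU
  have cg1 : ∀ m, ContinuousOn (fun y => fderiv ℝ g y (b m)) (closedBall x σ) := fun m =>
    (hg1 m).continuousOn.mono hxU
  have cg2 : ∀ m n, ContinuousOn (fun y => fderiv ℝ (fun z => fderiv ℝ g z (b m)) y (b n))
      (closedBall x σ) := fun m n => (hg2 m n).continuousOn.mono hxU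
  have hKc : IsCompact (closedBall x σ) := isCompact_closedBall x σ
  /- ───── the given integrals at `x` ───── -/
  have hP : ∫ y in closedBall x σ, u y ^ 2 ≤ K₀ * r ^ q := by
    have := hI x hxr₁; rwa [← hr, ← hσdef] at this
  have hΓ₀ : ∫ y in closedBall x σ, g y ^ 2 ≤ K * r ^ (-5 : ℝ) := by
    have := (hG x hxr₁).1; rwa [← hr, ← hσdef] at this
  have hΓ₁ : ∀ m, ∫ y in closedBall x σ, (fderiv ℝ g y (b m)) ^ 2 ≤ K * r ^ (-7 : ℝ) := by
    have := (hG x hxr₁).2.1; rwa [← hr, ← hσdef] at this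
  have hΓ₂ : ∀ m n, ∫ y in closedBall x σ,
      (fderiv ℝ (fun z => fderiv ℝ g z (b m)) y (b n)) ^ 2 ≤ K * r ^ (-9 : ℝ) := by
    have := (hG x hxr₁).2.2; rwa [← hr, ← hσdef] at this
  have hP0 : 0 ≤ ∫ y in closedBall x σ, u y ^ 2 :=
    setIntegral_nonneg measurableSet_closedBall fun y _ => sq_nonneg _
  /- ───── the `L` identities ───── -/
  have hL2 : (M / σ) ^ 2 = (M / θ) ^ 2 * r ^ (-2 : ℝ) := by
    rw [hL, mul_pow, ← Real.rpow_natCast (r ^ (-1 : ℝ)), ← Real.rpow_mul hr0.le]; norm_num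
  have hL4 : (M / σ) ^ 4 = (M / θ) ^ 4 * r ^ (-4 : ℝ) := by
    rw [hL, mul_pow, ← Real.rpow_natCast (r ^ (-1 : ℝ)), ← Real.rpow_mul hr0.le]; norm_num
  have hMθ0 : 0 < M / θ := div_pos hM hθ
  have hL2inv : ((M / σ) ^ 2)⁻¹ = (θ / M) ^ 2 * r ^ (2 : ℝ) := by
    rw [hL2, mul_inv, ← Real.rpow_neg hr0.le, neg_neg, ← inv_pow, inv_div]
  /- ═════ level zero ═════ -/
  obtain ⟨hE₁, hE₂, hsup₀⟩ := level_zero_ball hMC hU hσ hxU hu hg hε0 hε heq ha'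
    (fun y hy => (hβ_ball y hy).trans hΛ₁L) (fun y hy => (hc_ball y hy).trans hΛ₂L)
  -- the two inputs of the crude bounds
  have hin1 : (M / σ) ^ 2 * (∫ y in closedBall x σ, u y ^ 2) ≤ (M / θ) ^ 2 * K₀ * r ^ (q - 2) := by
    rw [hL2]
    calc (M / θ) ^ 2 * r ^ (-2 : ℝ) * ∫ y in closedBall x σ, u y ^ 2
        ≤ (M / θ) ^ 2 * r ^ (-2 : ℝ) * (K₀ * r ^ q) :=
          mul_le_mul_of_nonneg_left hP (by positivity)
      _ = (M / θ) ^ 2 * K₀ * (r ^ (-2 : ℝ) * r ^ q) := by ring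
      _ = (M / θ) ^ 2 * K₀ * r ^ (q - 2) := by rw [hpw]; ring_nf
  have hin2 : (∫ y in closedBall x σ, g y ^ 2) / (M / σ) ^ 2 ≤ K * (θ / M) ^ 2 * r ^ (q - 2) := by
    rw [div_eq_mul_inv, hL2inv]
    calc (∫ y in closedBall x σ, g y ^ 2) * ((θ / M) ^ 2 * r ^ (2 : ℝ))
        ≤ K * r ^ (-5 : ℝ) * ((θ / M) ^ 2 * r ^ (2 : ℝ)) :=
          mul_le_mul_of_nonneg_right hΓ₀ (by positivity)
      _ = K * (θ / M) ^ 2 * (r ^ (-5 : ℝ) * r ^ (2 : ℝ)) := by ring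
      _ = K * (θ / M) ^ 2 * r ^ (-3 : ℝ) := by rw [hpw]; norm_num
      _ ≤ K * (θ / M) ^ 2 * r ^ (q - 2) :=
          mul_le_mul_of_nonneg_left (hmo (by linarith only [hq])) (by positivity)
  have hin3 : (M / σ) ^ 4 * (∫ y in closedBall x σ, u y ^ 2) ≤ (M / θ) ^ 4 * K₀ * r ^ (q - 4) := by
    rw [hL4]
    calc (M / θ) ^ 4 * r ^ (-4 : ℝ) * ∫ y in closedBall x σ, u y ^ 2
        ≤ (M / θ) ^ 4 * r ^ (-4 : ℝ) * (K₀ * r ^ q) :=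
          mul_le_mul_of_nonneg_left hP (by positivity)
      _ = (M / θ) ^ 4 * K₀ * (r ^ (-4 : ℝ) * r ^ q) := by ring
      _ = (M / θ) ^ 4 * K₀ * r ^ (q - 4) := by rw [hpw]; ring_nf
  have hin4 : (∫ y in closedBall x σ, g y ^ 2) ≤ K * r ^ (q - 4) :=
    hΓ₀.trans (mul_le_mul_of_nonneg_left (hmo (by linarith only [hq])) hK)
  -- `E₁ ≤ A₁ r^{q-2}`, `E₂ ≤ A₂ r^{q-4}`, `u² ≤ θ A₂ r^{q-3}`
  have hE₁' : ∫ y in ball x (σ / 2), ∑ i, (fderiv ℝ u y (b i)) ^ 2 ≤ A₁ * r ^ (q - 2) := by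
    refine hE₁.trans ?_
    rw [hA₁]
    nlinarith only [hin1, hin2, hC0, mul_nonneg hC0 (hrp0 (q - 2)).le]
  have hX₀ : C₀ * ((M / σ) ^ 4 * (∫ y in closedBall x σ, u y ^ 2) + ∫ y in closedBall x σ, g y ^ 2) ≤
      A₂ * r ^ (q - 4) := by
    rw [hA₂]
    nlinarith only [hin3, hin4, hC0, mul_nonneg hC0 (hrp0 (q - 4)).le]
  have hE₂' : ∫ y in ball x (σ / 2), ∑ i, ∑ j, (fderiv ℝ (fun z => fderiv ℝ u z (b i)) y (b j)) ^ 2 ≤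
      A₂ * r ^ (q - 4) := hE₂.trans hX₀
  have hrr : ∀ s : ℝ, r * r ^ s = r ^ (s + 1) := fun s => by
    calc r * r ^ s = r ^ (1 : ℝ) * r ^ s := by rw [Real.rpow_one]
      _ = r ^ (s + 1) := by rw [hpw]; ring_nf
  have hrσ : σ * r ^ (q - 4) = θ * r ^ (q - 3) := by
    rw [hσdef, mul_assoc, hrr]; ring_nf
  have hsup₀' : u x ^ 2 ≤ θ * A₂ * r ^ (q - 3) := by
    have h := hsup₀ x (mem_closedBall_self (by positivity))
    refine h.trans ?_
    calc C₀ * σ * ((M / σ) ^ 4 * (∫ y in closedBall x σ, u y ^ 2) + ∫ y in closedBall x σ, g y ^ 2)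
        = σ * (C₀ * ((M / σ) ^ 4 * (∫ y in closedBall x σ, u y ^ 2) + ∫ y in closedBall x σ, g y ^ 2)) := by
          ring
      _ ≤ σ * (A₂ * r ^ (q - 4)) := mul_le_mul_of_nonneg_left hX₀ hσ.le
      _ = θ * A₂ * r ^ (q - 3) := by rw [← mul_assoc, mul_comm σ A₂, mul_assoc, hrσ]; ring
  /- ───── integrals on smaller balls ───── -/
  have hsub₁ : closedBall x (σ / 2) ⊆ closedBall x σ := closedBall_subset_closedBall (by linarith only [hσ])
  have hsub₂ : closedBall x (σ / 4) ⊆ closedBall x σ := closedBall_subset_closedBall (by linarith only [hσ])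
  have hsub₂₁ : closedBall x (σ / 4) ⊆ closedBall x (σ / 2) :=
    closedBall_subset_closedBall (by linarith only [hσ])
  have hK₁ : IsCompact (closedBall x (σ / 2)) := isCompact_closedBall x _
  have hK₂ : IsCompact (closedBall x (σ / 4)) := isCompact_closedBall x _
  -- `∫_{B̄(σ/2)} ΣΣ(∂∂u)² ≤ A₂ r^{q-4}`, `∫_{B̄(σ/2)} Σ(∂u)² ≤ A₁ r^{q-2}`, `∫_{B̄ ρ} u² ≤ K₀ r^q`
  have hI2half : ∫ y in closedBall x (σ / 2), ∑ i, ∑ j,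
      (fderiv ℝ (fun z => fderiv ℝ u z (b i)) y (b j)) ^ 2 ≤ A₂ * r ^ (q - 4) := by
    rw [setIntegral_closedBall_eq_ball]; exact hE₂'
  have hI1half : ∫ y in closedBall x (σ / 2), ∑ i, (fderiv ℝ u y (b i)) ^ 2 ≤ A₁ * r ^ (q - 2) := by
    rw [setIntegral_closedBall_eq_ball]; exact hE₁'
  have hI0sub : ∀ {s : Set E3}, s ⊆ closedBall x σ → ∫ y in s, u y ^ 2 ≤ K₀ * r ^ q := fun hs =>
    (setIntegral_le_setIntegral_of_le hKc hs (cu0.pow 2) (cu0.pow 2) (fun y _ => sq_nonneg _)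
      (fun y _ => le_rfl)).trans hP
  -- single terms against sums, on sub-balls of `B̄(σ/2)`
  have hI1single : ∀ {s : Set E3}, s ⊆ closedBall x (σ / 2) → ∀ m,
      ∫ y in s, (fderiv ℝ u y (b m)) ^ 2 ≤ A₁ * r ^ (q - 2) := by
    intro s hs m
    refine (setIntegral_le_setIntegral_of_le hK₁ hs ((cu1 m).mono hsub₁ |>.pow 2)
      (continuousOn_finsetSum _ fun i _ => ((cu1 i).mono hsub₁).pow 2) (fun y _ => sq_nonneg _)
      (fun y _ => ?_)).trans hI1half
    exact Finset.single_le_sum (f := fun i => (fderiv ℝ u y (b i)) ^ 2) (fun i _ => sq_nonneg _)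
      (Finset.mem_univ m)
  have hI2single : ∀ {s : Set E3}, s ⊆ closedBall x (σ / 2) → ∀ m n,
      ∫ y in s, (fderiv ℝ (fun z => fderiv ℝ u z (b m)) y (b n)) ^ 2 ≤ A₂ * r ^ (q - 4) := by
    intro s hs m n
    refine (setIntegral_le_setIntegral_of_le hK₁ hs (((cu2 m n).mono hsub₁).pow 2)
      (continuousOn_finsetSum _ fun i _ => continuousOn_finsetSum _ fun j _ =>
        ((cu2 i j).mono hsub₁).pow 2) (fun y _ => sq_nonneg _) (fun y _ => ?_)).trans hI2half
    calc (fderiv ℝ (fun z => fderiv ℝ u z (b m)) y (b n)) ^ 2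
        ≤ ∑ j, (fderiv ℝ (fun z => fderiv ℝ u z (b m)) y (b j)) ^ 2 :=
          Finset.single_le_sum (f := fun j => (fderiv ℝ (fun z => fderiv ℝ u z (b m)) y (b j)) ^ 2)
            (fun j _ => sq_nonneg _) (Finset.mem_univ n)
      _ ≤ ∑ i, ∑ j, (fderiv ℝ (fun z => fderiv ℝ u z (b i)) y (b j)) ^ 2 :=
          Finset.single_le_sum (f := fun i => ∑ j, (fderiv ℝ (fun z => fderiv ℝ u z (b i)) y (b j)) ^ 2)
            (fun i _ => Finset.sum_nonneg fun j _ => sq_nonneg _) (Finset.mem_univ m)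
  have hI2sub : ∀ {s : Set E3}, s ⊆ closedBall x (σ / 2) →
      ∫ y in s, ∑ i, ∑ j, (fderiv ℝ (fun z => fderiv ℝ u z (b i)) y (b j)) ^ 2 ≤ A₂ * r ^ (q - 4) := by
    intro s hs
    refine (setIntegral_le_setIntegral_of_le hK₁ hs ?_ ?_
      (fun y _ => Finset.sum_nonneg fun i _ => Finset.sum_nonneg fun j _ => sq_nonneg _)
      (fun y _ => le_rfl)).trans hI2half <;>
    exact continuousOn_finsetSum _ fun i _ => continuousOn_finsetSum _ fun j _ =>
      ((cu2 i j).mono hsub₁).pow 2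
  have hI1sub : ∀ {s : Set E3}, s ⊆ closedBall x (σ / 2) →
      ∫ y in s, ∑ i, (fderiv ℝ u y (b i)) ^ 2 ≤ A₁ * r ^ (q - 2) := by
    intro s hs
    refine (setIntegral_le_setIntegral_of_le hK₁ hs ?_ ?_
      (fun y _ => Finset.sum_nonneg fun i _ => sq_nonneg _) (fun y _ => le_rfl)).trans hI1half <;>
    exact continuousOn_finsetSum _ fun i _ => ((cu1 i).mono hsub₁).pow 2
  -- the `Q₀` integral on sub-balls of `B̄(σ/2)`
  have hQ0 : ∀ {s : Set E3}, s ⊆ closedBall x (σ / 2) → MeasurableSet s →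
      ∫ y in s, (∑ i, ∑ j, (fderiv ℝ (fun z => fderiv ℝ u z (b i)) y (b j)) ^ 2
        + ∑ i, (fderiv ℝ u y (b i)) ^ 2 + u y ^ 2) ≤ (A₂ + A₁ + K₀) * r ^ q := by
    intro s hs hsm
    have hint : ∀ {f : E3 → ℝ}, ContinuousOn f (closedBall x σ) → IntegrableOn f s := fun hf =>
      ((hf.mono hsub₁).integrableOn_compact hK₁).mono_set hs
    have c2 : ContinuousOn (fun y => ∑ i, ∑ j, (fderiv ℝ (fun z => fderiv ℝ u z (b i)) y (b j)) ^ 2)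
        (closedBall x σ) :=
      continuousOn_finsetSum _ fun i _ => continuousOn_finsetSum _ fun j _ => (cu2 i j).pow 2
    have c1 : ContinuousOn (fun y => ∑ i, (fderiv ℝ u y (b i)) ^ 2) (closedBall x σ) :=
      continuousOn_finsetSum _ fun i _ => (cu1 i).pow 2
    have c0 : ContinuousOn (fun y => u y ^ 2) (closedBall x σ) := cu0.pow 2
    have i2 : IntegrableOn (fun y => ∑ i, ∑ j, (fderiv ℝ (fun z => fderiv ℝ u z (b i)) y (b j)) ^ 2) s :=
      hint c2
    have i1 : IntegrableOn (fun y => ∑ i, (fderiv ℝ u y (b i)) ^ 2) s := hint c1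
    have i0 : IntegrableOn (fun y => u y ^ 2) s := hint c0
    have i21 : IntegrableOn (fun y => ∑ i, ∑ j, (fderiv ℝ (fun z => fderiv ℝ u z (b i)) y (b j)) ^ 2
        + ∑ i, (fderiv ℝ u y (b i)) ^ 2) s := i2.add i1
    rw [integral_add i21 i0, integral_add i2 i1]
    have h2 := hI2sub hs
    have h1 := hI1sub hs
    have h0 := hI0sub (hs.trans hsub₁)
    have m4 : r ^ (q - 4) ≤ r ^ q := hmo (by linarith only [])
    have m2 : r ^ (q - 2) ≤ r ^ q := hmo (by linarith only [])
    nlinarith only [h2, h1, h0, m4, m2, hA₂0, hA₁0, mul_le_mul_of_nonneg_left m4 hA₂0,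
      mul_le_mul_of_nonneg_left m2 hA₁0]
  -- the right-hand side integrals on sub-balls
  have hΓ₁sub : ∀ {s : Set E3}, s ⊆ closedBall x σ → ∀ m,
      ∫ y in s, (fderiv ℝ g y (b m)) ^ 2 ≤ K * r ^ (-7 : ℝ) := fun hs m =>
    (setIntegral_le_setIntegral_of_le hKc hs ((cg1 m).pow 2) ((cg1 m).pow 2)
      (fun y _ => sq_nonneg _) (fun y _ => le_rfl)).trans (hΓ₁ m)
  have hΓ₂sub : ∀ {s : Set E3}, s ⊆ closedBall x σ → ∀ m n,
      ∫ y in s, (fderiv ℝ (fun z => fderiv ℝ g z (b m)) y (b n)) ^ 2 ≤ K * r ^ (-9 : ℝ) := fun hs m n =>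
    (setIntegral_le_setIntegral_of_le hKc hs ((cg2 m n).pow 2) ((cg2 m n).pow 2)
      (fun y _ => sq_nonneg _) (fun y _ => le_rfl)).trans (hΓ₂ m n)
  -- squares of `Λ₁`, `Λ₂`
  have hΛ₁sq : Λ₁ ^ 2 = 9 * K ^ 2 * r ^ (-6 : ℝ) := by
    rw [hΛ₁def, mul_pow, mul_pow, ← Real.rpow_natCast (r ^ (-3 : ℝ)), ← Real.rpow_mul hr0.le]
    norm_num
  have hΛ₂sq : Λ₂ ^ 2 = 16 * K ^ 2 * r ^ (-8 : ℝ) := by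
    rw [hΛ₂def, mul_pow, mul_pow, ← Real.rpow_natCast (r ^ (-4 : ℝ)), ← Real.rpow_mul hr0.le]
    norm_num
  /- ═════ level one ═════ -/
  have hσ₁ : 0 < σ / 2 := by linarith only [hσ]
  have hxU₁ : closedBall x (σ / 2) ⊆ U := hsub₁.trans hxU
  have hLm₁ : M / σ ≤ M / (σ / 2) := hMσ_mono hσ₁ (by linarith only [hσ])
  have hL₁eq : M / (σ / 2) = 2 * (M / σ) := by field_simp
  have hlev1 : ∀ m,
      (∫ y in ball x (σ / 2 / 2), ∑ i, ∑ j, (fderiv ℝ (fun z => fderiv ℝ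
          (fun z' => fderiv ℝ u z' (b m)) z (b i)) y (b j)) ^ 2) ≤ A₃ * r ^ (q - 6) ∧
      (∫ y in ball x (σ / 2 / 2), ∑ i, (fderiv ℝ (fun z => fderiv ℝ u z (b m)) y (b i)) ^ 2)
          ≤ A₄ * r ^ (q - 4) ∧
      (fderiv ℝ u x (b m)) ^ 2 ≤ A₃ * r ^ (q - 5) := by
    intro m
    obtain ⟨hE11, hE21, hsup₁⟩ := level_one_ball hC0 hM hMC hU hσ₁ hxU₁ hu hg has hβs hcs hε0 hε
      heq (fun y hy => ha' y (hsub₁ hy))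
      (fun y hy => (hβ_ball y (hsub₁ hy)).trans (hΛ₁L.trans hLm₁))
      (fun y hy => (hc_ball y (hsub₁ hy)).trans (hΛ₂L.trans
        (pow_le_pow_left₀ (div_pos hM hσ).le hLm₁ 2)))
      (fun y hy i => hΛ₁' y (hsub₁ hy) i) m
    -- inputs
    have hP₁ : ∫ y in closedBall x (σ / 2), (fderiv ℝ u y (b m)) ^ 2 ≤ A₁ * r ^ (q - 2) :=
      hI1single Subset.rfl m
    have hP₁0 : 0 ≤ ∫ y in closedBall x (σ / 2), (fderiv ℝ u y (b m)) ^ 2 :=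
      setIntegral_nonneg measurableSet_closedBall fun y _ => sq_nonneg _
    have hΓ₁' : 2 * (∫ y in closedBall x (σ / 2), (fderiv ℝ g y (b m)) ^ 2)
        + 54 * Λ₁ ^ 2 * (∫ y in closedBall x (σ / 2),
          (∑ i, ∑ j, (fderiv ℝ (fun z => fderiv ℝ u z (b i)) y (b j)) ^ 2
            + ∑ i, (fderiv ℝ u y (b i)) ^ 2 + u y ^ 2)) ≤ B₁ * r ^ (q - 6) := by
      have h1 := hΓ₁sub hsub₁ m
      have h2 := hQ0 Subset.rfl measurableSet_closedBall
      have m7 : r ^ (-7 : ℝ) ≤ r ^ (q - 6) := hmo (by linarith only [hq])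
      have e6 : r ^ (-6 : ℝ) * r ^ q = r ^ (q - 6) := by rw [hpw]; ring_nf
      rw [hΛ₁sq, hB₁]
      have h3 : 54 * (9 * K ^ 2 * r ^ (-6 : ℝ)) * (∫ y in closedBall x (σ / 2),
            (∑ i, ∑ j, (fderiv ℝ (fun z => fderiv ℝ u z (b i)) y (b j)) ^ 2
              + ∑ i, (fderiv ℝ u y (b i)) ^ 2 + u y ^ 2)) ≤
          486 * K ^ 2 * (A₂ + A₁ + K₀) * r ^ (q - 6) := by
        have := mul_le_mul_of_nonneg_left h2 (by positivity : (0:ℝ) ≤ 486 * K ^ 2 * r ^ (-6 : ℝ))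
        rw [← e6]
        nlinarith only [this]
      nlinarith only [h1, h3, m7, hK]
    -- the `L₁` identities
    have hL₁2 : (M / (σ / 2)) ^ 2 = 4 * (M / θ) ^ 2 * r ^ (-2 : ℝ) := by rw [hL₁eq, mul_pow, hL2]; ring
    have hL₁4 : (M / (σ / 2)) ^ 4 = 16 * (M / θ) ^ 4 * r ^ (-4 : ℝ) := by rw [hL₁eq, mul_pow, hL4]; ring
    have hL₁2inv : ((M / (σ / 2)) ^ 2)⁻¹ = (θ / M) ^ 2 * r ^ (2 : ℝ) / 4 := by
      rw [hL₁eq, mul_pow, mul_inv, hL2inv]; ring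
    -- outputs
    have hΓ₁'0 : 0 ≤ B₁ * r ^ (q - 6) := mul_nonneg hB₁0 (hrp0 _).le
    have hX₁ : C₀ * ((M / (σ / 2)) ^ 4 * (∫ y in closedBall x (σ / 2), (fderiv ℝ u y (b m)) ^ 2)
        + (2 * (∫ y in closedBall x (σ / 2), (fderiv ℝ g y (b m)) ^ 2)
          + 54 * Λ₁ ^ 2 * ∫ y in closedBall x (σ / 2),
            (∑ i, ∑ j, (fderiv ℝ (fun z => fderiv ℝ u z (b i)) y (b j)) ^ 2
              + ∑ i, (fderiv ℝ u y (b i)) ^ 2 + u y ^ 2))) ≤ A₃ * r ^ (q - 6) := by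
      have e : r ^ (-4 : ℝ) * r ^ (q - 2) = r ^ (q - 6) := by rw [hpw]; ring_nf
      have h1 : (M / (σ / 2)) ^ 4 * (∫ y in closedBall x (σ / 2), (fderiv ℝ u y (b m)) ^ 2) ≤
          16 * (M / θ) ^ 4 * A₁ * r ^ (q - 6) := by
        rw [hL₁4, ← e]
        have := mul_le_mul_of_nonneg_left hP₁ (by positivity : (0:ℝ) ≤ 16 * (M / θ) ^ 4 * r ^ (-4 : ℝ))
        nlinarith only [this]
      rw [hA₃]
      nlinarith only [h1, hΓ₁', hC0, mul_nonneg hC0 (hrp0 (q - 6)).le]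
    have hX₁' : C₀ * ((M / (σ / 2)) ^ 2 * (∫ y in closedBall x (σ / 2), (fderiv ℝ u y (b m)) ^ 2)
        + (2 * (∫ y in closedBall x (σ / 2), (fderiv ℝ g y (b m)) ^ 2)
          + 54 * Λ₁ ^ 2 * ∫ y in closedBall x (σ / 2),
            (∑ i, ∑ j, (fderiv ℝ (fun z => fderiv ℝ u z (b i)) y (b j)) ^ 2
              + ∑ i, (fderiv ℝ u y (b i)) ^ 2 + u y ^ 2)) / (M / (σ / 2)) ^ 2) ≤ A₄ * r ^ (q - 4) := by
      have e : r ^ (-2 : ℝ) * r ^ (q - 2) = r ^ (q - 4) := by rw [hpw]; ring_nf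
      have e' : r ^ (q - 6) * r ^ (2 : ℝ) = r ^ (q - 4) := by rw [hpw]; ring_nf
      have h1 : (M / (σ / 2)) ^ 2 * (∫ y in closedBall x (σ / 2), (fderiv ℝ u y (b m)) ^ 2) ≤
          4 * (M / θ) ^ 2 * A₁ * r ^ (q - 4) := by
        rw [hL₁2, ← e]
        have := mul_le_mul_of_nonneg_left hP₁ (by positivity : (0:ℝ) ≤ 4 * (M / θ) ^ 2 * r ^ (-2 : ℝ))
        nlinarith only [this]
      have h2 : (2 * (∫ y in closedBall x (σ / 2), (fderiv ℝ g y (b m)) ^ 2)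
          + 54 * Λ₁ ^ 2 * ∫ y in closedBall x (σ / 2),
            (∑ i, ∑ j, (fderiv ℝ (fun z => fderiv ℝ u z (b i)) y (b j)) ^ 2
              + ∑ i, (fderiv ℝ u y (b i)) ^ 2 + u y ^ 2)) / (M / (σ / 2)) ^ 2 ≤
          B₁ * (θ / M) ^ 2 / 4 * r ^ (q - 4) := by
        rw [div_eq_mul_inv, hL₁2inv, ← e']
        have := mul_le_mul_of_nonneg_right hΓ₁' (by positivity : (0:ℝ) ≤ (θ / M) ^ 2 * r ^ (2 : ℝ) / 4)
        nlinarith only [this]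
      rw [hA₄]
      nlinarith only [h1, h2, hC0, mul_nonneg hC0 (hrp0 (q - 4)).le]
    refine ⟨hE21.trans hX₁, hE11.trans hX₁', ?_⟩
    have hxm : x ∈ closedBall x (σ / 2 / 2) := mem_closedBall_self (by positivity)
    refine (hsup₁ x hxm).trans ?_
    have e : σ / 2 * r ^ (q - 6) = θ / 2 * r ^ (q - 5) := by
      rw [hσdef]
      have := hrr (q - 6)
      calc θ * r / 2 * r ^ (q - 6) = θ / 2 * (r * r ^ (q - 6)) := by ring
        _ = θ / 2 * r ^ (q - 5) := by rw [this]; ring_nf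
    calc C₀ * (σ / 2) * ((M / (σ / 2)) ^ 4 * (∫ y in closedBall x (σ / 2), (fderiv ℝ u y (b m)) ^ 2)
          + (2 * (∫ y in closedBall x (σ / 2), (fderiv ℝ g y (b m)) ^ 2)
            + 54 * Λ₁ ^ 2 * ∫ y in closedBall x (σ / 2),
              (∑ i, ∑ j, (fderiv ℝ (fun z => fderiv ℝ u z (b i)) y (b j)) ^ 2
                + ∑ i, (fderiv ℝ u y (b i)) ^ 2 + u y ^ 2)))
        = σ / 2 * (C₀ * ((M / (σ / 2)) ^ 4 * (∫ y in closedBall x (σ / 2), (fderiv ℝ u y (b m)) ^ 2)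
          + (2 * (∫ y in closedBall x (σ / 2), (fderiv ℝ g y (b m)) ^ 2)
            + 54 * Λ₁ ^ 2 * ∫ y in closedBall x (σ / 2),
              (∑ i, ∑ j, (fderiv ℝ (fun z => fderiv ℝ u z (b i)) y (b j)) ^ 2
                + ∑ i, (fderiv ℝ u y (b i)) ^ 2 + u y ^ 2)))) := by ring
      _ ≤ σ / 2 * (A₃ * r ^ (q - 6)) := mul_le_mul_of_nonneg_left hX₁ hσ₁.le
      _ = θ / 2 * A₃ * r ^ (q - 5) := by
          calc σ / 2 * (A₃ * r ^ (q - 6)) = A₃ * (σ / 2 * r ^ (q - 6)) := by ring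
            _ = θ / 2 * A₃ * r ^ (q - 5) := by rw [e]; ring
      _ ≤ A₃ * r ^ (q - 5) := by
          have : θ / 2 ≤ 1 := by linarith only [hθ4]
          have h0 : 0 ≤ A₃ * r ^ (q - 5) := mul_nonneg hA₃0 (hrp0 _).le
          nlinarith only [this, h0]
  /- ═════ level two ═════ -/
  have hσ₂ : 0 < σ / 4 := by linarith only [hσ]
  have hxU₂ : closedBall x (σ / 4) ⊆ U := hsub₂.trans hxU
  have hLm₂ : M / σ ≤ M / (σ / 4) := hMσ_mono hσ₂ (by linarith only [hσ])
  have hL₂eq : M / (σ / 4) = 4 * (M / σ) := by field_simp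
  have e24 : σ / 2 / 2 = σ / 4 := by ring
  have hlev2 : ∀ m n,
      (∫ y in ball x (σ / 4 / 2), ∑ i, ∑ j, (fderiv ℝ (fun z => fderiv ℝ
        (fun z' => fderiv ℝ (fun z'' => fderiv ℝ u z'' (b m)) z' (b n)) z (b i)) y (b j)) ^ 2)
          ≤ A₅ * r ^ (q - 8) ∧
      (fderiv ℝ (fun z' => fderiv ℝ u z' (b m)) x (b n)) ^ 2 ≤ A₅ * r ^ (q - 7) := by
    intro m n
    obtain ⟨hE22, hsup₂⟩ := level_two_ball hC0 hMC hU hσ₂ hxU₂ hu hg has hβs hcs hε0 hε heq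
      (fun y hy => ha' y (hsub₂ hy))
      (fun y hy => (hβ_ball y (hsub₂ hy)).trans (hΛ₁L.trans hLm₂))
      (fun y hy => (hc_ball y (hsub₂ hy)).trans (hΛ₂L.trans
        (pow_le_pow_left₀ (div_pos hM hσ).le hLm₂ 2)))
      (fun y hy i => hΛ₁' y (hsub₂ hy) i) (fun y hy i j => hΛ₂' y (hsub₂ hy) i j) m n
    -- inputs
    have hP₂ : ∫ y in closedBall x (σ / 4),
        (fderiv ℝ (fun z' => fderiv ℝ u z' (b m)) y (b n)) ^ 2 ≤ A₂ * r ^ (q - 4) :=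
      hI2single hsub₂₁ m n
    have hQi : ∀ i, ∫ y in closedBall x (σ / 4),
        (∑ k, ∑ l, (fderiv ℝ (fun z => fderiv ℝ (fun z' => fderiv ℝ u z' (b i)) z (b k)) y (b l)) ^ 2
          + ∑ k, (fderiv ℝ (fun z => fderiv ℝ u z (b i)) y (b k)) ^ 2 + (fderiv ℝ u y (b i)) ^ 2)
        ≤ (A₃ + A₄ + A₁) * r ^ (q - 2) := by
      intro i
      have hint : ∀ {f : E3 → ℝ}, ContinuousOn f (closedBall x σ) → IntegrableOn f (closedBall x (σ / 4)) :=
        fun hf => (hf.mono hsub₂).integrableOn_compact hK₂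
      have c3 : ContinuousOn (fun y => ∑ k, ∑ l, (fderiv ℝ (fun z =>
          fderiv ℝ (fun z' => fderiv ℝ u z' (b i)) z (b k)) y (b l)) ^ 2) (closedBall x σ) :=
        continuousOn_finsetSum _ fun k _ => continuousOn_finsetSum _ fun l _ => (cu3 i k l).pow 2
      have c2 : ContinuousOn (fun y => ∑ k, (fderiv ℝ (fun z => fderiv ℝ u z (b i)) y (b k)) ^ 2)
          (closedBall x σ) := continuousOn_finsetSum _ fun k _ => (cu2 i k).pow 2
      have c1 : ContinuousOn (fun y => (fderiv ℝ u y (b i)) ^ 2) (closedBall x σ) := (cu1 i).pow 2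
      have i3 : IntegrableOn (fun y => ∑ k, ∑ l, (fderiv ℝ (fun z =>
          fderiv ℝ (fun z' => fderiv ℝ u z' (b i)) z (b k)) y (b l)) ^ 2) (closedBall x (σ / 4)) := hint c3
      have i2 : IntegrableOn (fun y => ∑ k, (fderiv ℝ (fun z => fderiv ℝ u z (b i)) y (b k)) ^ 2)
          (closedBall x (σ / 4)) := hint c2
      have i1 : IntegrableOn (fun y => (fderiv ℝ u y (b i)) ^ 2) (closedBall x (σ / 4)) := hint c1
      have i32 : IntegrableOn (fun y => ∑ k, ∑ l, (fderiv ℝ (fun z =>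
          fderiv ℝ (fun z' => fderiv ℝ u z' (b i)) z (b k)) y (b l)) ^ 2
          + ∑ k, (fderiv ℝ (fun z => fderiv ℝ u z (b i)) y (b k)) ^ 2) (closedBall x (σ / 4)) := i3.add i2
      rw [integral_add i32 i1, integral_add i3 i2]
      obtain ⟨h3, h2, -⟩ := hlev1 i
      rw [e24] at h3 h2
      rw [← setIntegral_closedBall_eq_ball] at h3 h2
      have h1 := hI1single hsub₂₁ i
      have m6 : r ^ (q - 6) ≤ r ^ (q - 2) := hmo (by linarith only [])
      have m4 : r ^ (q - 4) ≤ r ^ (q - 2) := hmo (by linarith only [])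
      nlinarith only [h3, h2, h1, mul_le_mul_of_nonneg_left m6 hA₃0, mul_le_mul_of_nonneg_left m4 hA₄0]
    have hQ0₂ := hQ0 hsub₂₁ measurableSet_closedBall
    have hΓg₂ := hΓ₂sub hsub₂ m n
    have hΓ₂' : 4 * (∫ y in closedBall x (σ / 4), (fderiv ℝ (fun z => fderiv ℝ g z (b m)) y (b n)) ^ 2)
        + 108 * Λ₁ ^ 2 * ((∫ y in closedBall x (σ / 4),
            (∑ k, ∑ l, (fderiv ℝ (fun z => fderiv ℝ (fun z' => fderiv ℝ u z' (b m)) z (b k)) y (b l)) ^ 2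
              + ∑ k, (fderiv ℝ (fun z => fderiv ℝ u z (b m)) y (b k)) ^ 2 + (fderiv ℝ u y (b m)) ^ 2))
          + ∫ y in closedBall x (σ / 4),
            (∑ k, ∑ l, (fderiv ℝ (fun z => fderiv ℝ (fun z' => fderiv ℝ u z' (b n)) z (b k)) y (b l)) ^ 2
              + ∑ k, (fderiv ℝ (fun z => fderiv ℝ u z (b n)) y (b k)) ^ 2 + (fderiv ℝ u y (b n)) ^ 2))
        + 108 * Λ₂ ^ 2 * (∫ y in closedBall x (σ / 4),
            (∑ i, ∑ j, (fderiv ℝ (fun z => fderiv ℝ u z (b i)) y (b j)) ^ 2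
              + ∑ i, (fderiv ℝ u y (b i)) ^ 2 + u y ^ 2)) ≤ B₂ * r ^ (q - 8) := by
      have hm := hQi m
      have hn := hQi n
      have m9 : r ^ (-9 : ℝ) ≤ r ^ (q - 8) := hmo (by linarith only [hq])
      have e6 : r ^ (-6 : ℝ) * r ^ (q - 2) = r ^ (q - 8) := by rw [hpw]; ring_nf
      have e8 : r ^ (-8 : ℝ) * r ^ q = r ^ (q - 8) := by rw [hpw]; ring_nf
      rw [hΛ₁sq, hΛ₂sq, hB₂]
      have t1 : 108 * (9 * K ^ 2 * r ^ (-6 : ℝ)) * ((∫ y in closedBall x (σ / 4),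
            (∑ k, ∑ l, (fderiv ℝ (fun z => fderiv ℝ (fun z' => fderiv ℝ u z' (b m)) z (b k)) y (b l)) ^ 2
              + ∑ k, (fderiv ℝ (fun z => fderiv ℝ u z (b m)) y (b k)) ^ 2 + (fderiv ℝ u y (b m)) ^ 2))
          + ∫ y in closedBall x (σ / 4),
            (∑ k, ∑ l, (fderiv ℝ (fun z => fderiv ℝ (fun z' => fderiv ℝ u z' (b n)) z (b k)) y (b l)) ^ 2
              + ∑ k, (fderiv ℝ (fun z => fderiv ℝ u z (b n)) y (b k)) ^ 2 + (fderiv ℝ u y (b n)) ^ 2)) ≤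
          1944 * K ^ 2 * (A₃ + A₄ + A₁) * r ^ (q - 8) := by
        have hsum := add_le_add hm hn
        have := mul_le_mul_of_nonneg_left hsum (by positivity : (0:ℝ) ≤ 972 * K ^ 2 * r ^ (-6 : ℝ))
        rw [← e6]
        nlinarith only [this]
      have t2 : 108 * (16 * K ^ 2 * r ^ (-8 : ℝ)) * (∫ y in closedBall x (σ / 4),
            (∑ i, ∑ j, (fderiv ℝ (fun z => fderiv ℝ u z (b i)) y (b j)) ^ 2
              + ∑ i, (fderiv ℝ u y (b i)) ^ 2 + u y ^ 2)) ≤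
          1728 * K ^ 2 * (A₂ + A₁ + K₀) * r ^ (q - 8) := by
        have := mul_le_mul_of_nonneg_left hQ0₂ (by positivity : (0:ℝ) ≤ 1728 * K ^ 2 * r ^ (-8 : ℝ))
        rw [← e8]
        nlinarith only [this]
      nlinarith only [hΓg₂, t1, t2, m9, hK]
    -- outputs
    have hL₂4 : (M / (σ / 4)) ^ 4 = 256 * (M / θ) ^ 4 * r ^ (-4 : ℝ) := by rw [hL₂eq, mul_pow, hL4]; ring
    have hX₂ : C₀ * ((M / (σ / 4)) ^ 4 * (∫ y in closedBall x (σ / 4),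
          (fderiv ℝ (fun z' => fderiv ℝ u z' (b m)) y (b n)) ^ 2)
        + (4 * (∫ y in closedBall x (σ / 4), (fderiv ℝ (fun z => fderiv ℝ g z (b m)) y (b n)) ^ 2)
          + 108 * Λ₁ ^ 2 * ((∫ y in closedBall x (σ / 4),
              (∑ k, ∑ l, (fderiv ℝ (fun z => fderiv ℝ (fun z' => fderiv ℝ u z' (b m)) z (b k)) y (b l)) ^ 2
                + ∑ k, (fderiv ℝ (fun z => fderiv ℝ u z (b m)) y (b k)) ^ 2 + (fderiv ℝ u y (b m)) ^ 2))
            + ∫ y in closedBall x (σ / 4),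
              (∑ k, ∑ l, (fderiv ℝ (fun z => fderiv ℝ (fun z' => fderiv ℝ u z' (b n)) z (b k)) y (b l)) ^ 2
                + ∑ k, (fderiv ℝ (fun z => fderiv ℝ u z (b n)) y (b k)) ^ 2 + (fderiv ℝ u y (b n)) ^ 2))
          + 108 * Λ₂ ^ 2 * ∫ y in closedBall x (σ / 4),
              (∑ i, ∑ j, (fderiv ℝ (fun z => fderiv ℝ u z (b i)) y (b j)) ^ 2
                + ∑ i, (fderiv ℝ u y (b i)) ^ 2 + u y ^ 2))) ≤ A₅ * r ^ (q - 8) := by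
      have e : r ^ (-4 : ℝ) * r ^ (q - 4) = r ^ (q - 8) := by rw [hpw]; ring_nf
      have h1 : (M / (σ / 4)) ^ 4 * (∫ y in closedBall x (σ / 4),
          (fderiv ℝ (fun z' => fderiv ℝ u z' (b m)) y (b n)) ^ 2) ≤ 256 * (M / θ) ^ 4 * A₂ * r ^ (q - 8) := by
        rw [hL₂4, ← e]
        have := mul_le_mul_of_nonneg_left hP₂ (by positivity : (0:ℝ) ≤ 256 * (M / θ) ^ 4 * r ^ (-4 : ℝ))
        nlinarith only [this]
      rw [hA₅]
      nlinarith only [h1, hΓ₂', hC0, mul_nonneg hC0 (hrp0 (q - 8)).le]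
    refine ⟨hE22.trans hX₂, ?_⟩
    have hxm : x ∈ closedBall x (σ / 4 / 2) := mem_closedBall_self (by positivity)
    refine (hsup₂ x hxm).trans ?_
    have e : σ / 4 * r ^ (q - 8) = θ / 4 * r ^ (q - 7) := by
      rw [hσdef]
      have := hrr (q - 8)
      calc θ * r / 4 * r ^ (q - 8) = θ / 4 * (r * r ^ (q - 8)) := by ring
        _ = θ / 4 * r ^ (q - 7) := by rw [this]; ring_nf
    have hθ41 : θ / 4 ≤ 1 := by linarith only [hθ4]
    have h0 : 0 ≤ A₅ * r ^ (q - 7) := mul_nonneg hA₅0 (hrp0 _).le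
    have key := mul_le_mul_of_nonneg_left hX₂ hσ₂.le
    have e2 : σ / 4 * (A₅ * r ^ (q - 8)) = θ / 4 * A₅ * r ^ (q - 7) := by
      calc σ / 4 * (A₅ * r ^ (q - 8)) = A₅ * (σ / 4 * r ^ (q - 8)) := by ring
        _ = θ / 4 * A₅ * r ^ (q - 7) := by rw [e]; ring
    rw [e2] at key
    nlinarith only [key, hθ41, h0, hC0]
  /- ═════ conclusion ═════ -/
  have hθ1 : θ ≤ 1 := by linarith only [hθ4]
  refine ⟨?_, fun m => ?_, fun m n => (hlev2 m n).2.trans ?_, fun m => ?_, fun m n => ?_⟩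
  · have h0 : 0 ≤ r ^ (q - 3) := (hrp0 _).le
    have h1 := mul_le_mul_of_nonneg_right hθ1 (mul_nonneg hA₂0 h0)
    have h2 : 0 ≤ A₃ * r ^ (q - 3) := mul_nonneg hA₃0 h0
    have h3 : 0 ≤ A₅ * r ^ (q - 3) := mul_nonneg hA₅0 h0
    nlinarith only [hsup₀', h1, h2, h3]
  · have h0 : 0 ≤ r ^ (q - 5) := (hrp0 _).le
    nlinarith only [(hlev1 m).2.2, h0, hA₂0, hA₃0, hA₅0]
  · have h0 : 0 ≤ r ^ (q - 7) := (hrp0 _).le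
    nlinarith only [h0, hA₂0, hA₃0, hA₅0]
  · have h := (hlev1 m).1
    rw [e24] at h
    have h0 : 0 ≤ r ^ (q - 6) := (hrp0 _).le
    nlinarith only [h, h0, hA₂0, hA₃0, hA₅0]
  · have h := (hlev2 m n).1
    have e48 : σ / 4 / 2 = σ / 8 := by ring
    rw [e48] at h
    have h0 : 0 ≤ r ^ (q - 8) := (hrp0 _).le
    nlinarith only [h, h0, hA₂0, hA₃0, hA₅0]

end Bootstrap

end Literature.Analysis.PDE
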